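import Mathlib
import Literature.NumberTheory.Irrationality.Lai2025TwoAdic.GeneralLinearFormsT
import Literature.NumberTheory.Irrationality.Lai2025TwoAdic.GeneralDerivativeExpansion
import Literature.NumberTheory.Irrationality.Lai2025TwoAdic.TwoAdicValuation
import Literature.NumberTheory.Irrationality.LaiSprangZudilin2026.TwoAdicEstimate
import HarnessLib

/-!
# Lai 2025 (IJNT, `2`-adic zeta values), §6 for GENERAL `s`, part 2: Lemma 6.1 and Lemma 6.3 —
# the exact `2`-adic valuation of `T_n` along `n = 2^m − 1` (`m ≥ 2`), hence `T_n ≠ 0` — PROVED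

Topic `Literature/NumberTheory/Irrationality/Lai2025TwoAdic`.  Source: L. Lai, *On the irrationality of certain
`2`-adic zeta values*, Int. J. Number Theory (2025) = arXiv:2304.00816 [Lai2025TwoAdicZeta], §2.2 (Lemmas 2.4–2.5) and
§6 (Lemmas 6.1–6.3) (held text `paper:arxiv-2304.00816`, chunks p0005–p0006, p0011–p0012, read on the page).  PROOF FILE
(definitions with bodies + theorems; no named fact, net debt 0); file 3b of the discharge of the tree's named fact
`PAdicZetaValues.lai2025TwoAdic_theorem13` for GENERAL `s` (the case `s = 0` is the sibling `TwoAdicValuation.lean`,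
whose `Δ_m`-calculus — `LipNatMod`, `norm_sub_volkenbornSum_le_of_lipNatMod`, `lipNatMod_Cq_sq`, `norm_Cq_le_half` — is
reused here).

## Source, as printed ([Lai2025TwoAdicZeta, §6])

* **Lemma 6.1.** «Let `m ≥ 2` be an integer and `n = 2^m − 1`.  Let `k₀ = 2^{m−1}`.  Then, for any integer `k` such that
  `1 ≤ k ≤ n` and `k ≠ k₀`, we have `v₂((k−1)!(n−k)!) ≥ v₂((k₀−1)!(n−k₀)!) + 1`.»
* **Lemma 6.3.** «For any integer `n` of the form `n = 2^m − 1` with `m ≥ 2`, we have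
  `v₂(d_n^{2s+3}T_n) = (6s+12)n + s + v₂((s+2)!)`.  In particular, `d_n^{2s+3}T_n ≠ 0` and
  `|d_n^{2s+3}T_n|₂ = 2^{(−6s−12+o(1))n}` as `n = 2^m − 1 → ∞`.»  *Proof* («word-by-word the same as the proof of
  Lemma 6.2»): `B_n(t+¼) = 2^{(5s+10)n+2s+4}f(t)`; by the Leibniz rule (eqn_Sum) `f^{(s)} = Σ_{(i_1,…,i_n,j)∈I} f_{(i,j)}`,
  `f_{(i,j)} = s!∏_k binom(s+2,i_k) · g^{(j)}/j! · n!^{2+j}binom(t+n,n)^{2+j} ∏_k((k−1)!(n−k)!binom(t+k−1,k−1)binom(t+n,n−k))^{i_k}`;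
  «the term corresponding to the index `(0,…,0,i_{2^{m−1}} = s,0,…,0)` dominates»:
  (eqn_dominating_term) `Δ_m(g·binom(t+2^m−1,2^m−1)²·binom(t+2^{m−1}−1,2^{m−1}−1)^s·binom(t+2^m−1,2^{m−1}−1)^s) ≥ −m+2`
  (Lemma 2.5), so by Lemma 2.4 its integral is `≡ 2^{−m}Σ_{k<2^m}(…)(k) (mod 2^{−m+1})`, and «`binom(k+2^m−1,2^m−1)` is even
  for `1 ≤ k ≤ 2^m−1` by either Kummer's or Lucas' theorem and `g(0) ≡ 1 (mod 2ℤ₂)`», giving valuation exactly `−m`;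
  (eqn_other_terms) every other term has `Δ ≥ −m+1`, integral of valuation `≥ −m`, and a coefficient of valuation at least
  one more than the dominating one: by Lemma 6.1 `v₂(n!^{2+j}∏_k((k−1)!(n−k)!)^{i_k}) ≥ 2(m−2) + (s+2)(n−2m+2) − i_*`
  (`i_* = i_{2^{m−1}} ≠ s`), and with `u = s − i_* ≥ 1`, «`u ≥ v₂((u+2)(u+1))`» gives
  `v₂(s!binom(s+2,i_*)) + s − i_* − v₂((s+2)!) ≥ 0`.

## What is formalised (all PROVED)

* `LipNatMod.mono/const_mul/finset_sum` (bookkeeping for the clause `Δ_m` of the sibling file).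
* **Lemma 6.1** in `2`-adic norm form: `norm_Ffac_le_half` (`‖(k−1)!(n−k)!‖₂ ≤ ½‖(k₀−1)!(n−k₀)!‖₂` for `k ≠ k₀`), through
  `(k−1)!(n−k)!·binom(n−1,k−1) = (n−1)!` and **Kummer's theorem** (Mathlib's `padicValNat_choose`) for `binom(2^m−2, ·)`:
  all `m−1` binary positions carry for `k−1 = 2^{m−1}−1` (`padicValNat_choose_middle`) and the position `m−1` does not
  carry otherwise (`padicValNat_choose_le_of_ne_middle`).
* `norm_choose_le_two_pow_mul` — «`u ≥ v₂((u+2)(u+1))`»: `‖binom(s+2,s−u)‖₂ ≤ 2^{u−1}‖binom(s+2,s)‖₂` (`1 ≤ u ≤ s`).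
* `odd_choose_mersenne` — `binom(2^m−1, r)` is odd (Lucas), so the dominating term is a unit at `k = 0`.
* The coefficients `coefQ` / the functions `PhiQ`, `Phi2` of (eqn_Sum) after the regrouping of the sibling
  `GeneralDerivativeExpansion.lean`, the identity `DBs_natCast_eq_sum`
  (`B_n^{(s)}(j+¼) = s!·2^{(5s+10)n+2s+4}·Σ_{(i,ι,λ)} coefQ·Phi2(j)` at every natural `j`), the domination
  `norm_coefQ_le_half` (`‖coef_{(i,ι,λ)}‖₂ ≤ ½‖coef_dom‖₂` off the dominating index) and the Lipschitz data
  (`lipNat_Phi2`, `lipNatMod_Phi2_dom`: `Δ ≥ −m+1`, `Δ_m ≥ −m+2`).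
* **Lemma 6.3**: `norm_Ts_mersenne` — `‖T_n‖₂ = ‖s!·2^{(5s+10)n+2s+4}·coef_dom‖₂·2^m` for `n = 2^m−1`, `m ≥ 2`;
  `Ts_mersenne_ne_zero` (**`T_n ≠ 0`**); and the smallness bound `norm_Ts_mersenne_le`
  (`‖T_n‖₂ ≤ 2^{(2s+3)m − (6s+12)n − 3s − 4}`, Legendre through the tree's `LaiSprangZudilin2026.norm_factorial_le`).

Cell zeta5-irr / pub-zeta5 (HONEST FRAMING: systematic search; no irrationality claim unless kernel-certified):
`2`-adic valuation of linear forms in `1, ζ₂(s+3,¼), …, ζ₂(2s+3,¼)`; nothing here bears on `ζ(5) ∈ ℝ`.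
-/

noncomputable section

open Finset Filter Topology
open Literature.NumberTheory.LocalFields
open Literature.NumberTheory.Irrationality.PAdicZetaValues
open Literature.NumberTheory.Irrationality.LaiSprangZudilin2026 (norm_natCast_eq_two_zpow norm_factorial_eq
  norm_two_pow norm_factorial_le)
open Literature.Analysis.Calculus
open scoped Nat

namespace Literature.NumberTheory.Irrationality.Lai2025TwoAdic

/-! ## §1. Bookkeeping for the clause `Δ_m` -/

section General

variable {p : ℕ} [hp : Fact p.Prime]

/-- Monotonicity of `Δ_m` in the constant. [cite: Lai2025TwoAdicZeta, Definition 2.3] -/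
theorem LipNatMod.mono {m : ℕ} {M M' : ℝ} {f : ℕ → ℚ_[p]} (hf : LipNatMod p m M f) (hMM' : M ≤ M') :
    LipNatMod p m M' f :=
  fun k h => (hf k h).trans (mul_le_mul_of_nonneg_right hMM' (norm_nonneg _))

/-- `Δ_m(c·f) ≥ v_p(c) + Δ_m(f)`. [cite: Lai2025TwoAdicZeta, Lemma 2.5 (2)] -/
theorem LipNatMod.const_mul {m : ℕ} {M : ℝ} {f : ℕ → ℚ_[p]} (hf : LipNatMod p m M f) (c : ℚ_[p]) :
    LipNatMod p m (‖c‖ * M) (fun k => c * f k) := by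
  intro k h
  show ‖c * f (k + p ^ m * h) - c * f k‖ ≤ ‖c‖ * M * ‖((p ^ m * h : ℕ) : ℚ_[p])‖
  rw [← mul_sub, norm_mul, mul_assoc]
  exact mul_le_mul_of_nonneg_left (hf k h) (norm_nonneg _)

/-- Finite sums (all with the same constant): `Δ_m(Σ f_i) ≥ min Δ_m(f_i)`. [cite: Lai2025TwoAdicZeta, Lemma 2.5 (2)] -/
theorem LipNatMod.finset_sum {ι : Type*} (S : Finset ι) {m : ℕ} {M : ℝ} {F : ι → ℕ → ℚ_[p]} (hM : 0 ≤ M)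
    (h : ∀ x ∈ S, LipNatMod p m M (F x)) : LipNatMod p m M (fun k => ∑ x ∈ S, F x k) := by
  classical
  induction S using Finset.induction_on with
  | empty => intro k h; simp; positivity
  | insert a S ha ih =>
    have h1 : LipNatMod p m M (F a) := h a (mem_insert_self _ _)
    have h2 := ih fun x hx => h x (mem_insert_of_mem hx)
    intro k hh
    simp only [Finset.sum_insert ha]
    have e : F a (k + p ^ m * hh) + ∑ x ∈ S, F x (k + p ^ m * hh) - (F a k + ∑ x ∈ S, F x k) =
        (F a (k + p ^ m * hh) - F a k) + (∑ x ∈ S, F x (k + p ^ m * hh) - ∑ x ∈ S, F x k) := by ring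
    rw [e]
    exact (IsUltrametricDist.norm_add_le_max _ _).trans (max_le (h1 k hh) (h2 k hh))

/-- `‖a‖_p ≤ 1` for a natural number `a`. [folklore] -/
private theorem norm_natCast_le_one (a : ℕ) : ‖(a : ℚ_[p])‖ ≤ 1 := by
  have := Padic.norm_int_le_one (p := p) (a : ℤ)
  rwa [Int.cast_natCast] at this

end General

/-! ## §2. Lemma 6.1: `v₂((k−1)!(n−k)!)` is minimal exactly at `k = k₀ = 2^{m−1}` (Kummer) -/

/-- `F_k := (k−1)!(n−k)!`. [cite: Lai2025TwoAdicZeta, Lemma 6.1] -/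
def Ffac (n k : ℕ) : ℕ := (k - 1)! * (n - k)!

/-- `F_k ≠ 0`. [cite: Lai2025TwoAdicZeta, Lemma 6.1] -/
theorem Ffac_ne_zero (n k : ℕ) : Ffac n k ≠ 0 :=
  mul_ne_zero (Nat.factorial_ne_zero _) (Nat.factorial_ne_zero _)

/-- `F_k · binom(n−1, k−1) = (n−1)!` for `1 ≤ k ≤ n`. [cite: Lai2025TwoAdicZeta, Lemma 6.1 (proof: v₂(a!) bookkeeping)] -/
theorem Ffac_mul_choose {n k : ℕ} (hk : k ∈ Icc 1 n) : Ffac n k * (n - 1).choose (k - 1) = (n - 1)! := by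
  have hk' := mem_Icc.1 hk
  have h := Nat.choose_mul_factorial_mul_factorial (show k - 1 ≤ n - 1 by omega)
  rw [show n - 1 - (k - 1) = n - k by omega] at h
  rw [Ffac, ← h]; ring

/-- `(2^a − 1) mod 2^i = 2^i − 1` for `i ≤ a` (the low `i` binary digits of `2^a − 1` are all `1`). [folklore] -/
private theorem two_pow_sub_one_mod {a i : ℕ} (hi : i ≤ a) : (2 ^ a - 1) % 2 ^ i = 2 ^ i - 1 := by
  have h1 : 2 ^ a = 2 ^ i * 2 ^ (a - i) := by rw [← pow_add, Nat.add_sub_cancel' hi]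
  have h2 : 1 ≤ 2 ^ (a - i) := Nat.one_le_two_pow
  have h3 : 1 ≤ 2 ^ i := Nat.one_le_two_pow
  have h4 : 2 ^ i ≤ 2 ^ i * 2 ^ (a - i) := Nat.le_mul_of_pos_right _ h2
  have e : 2 ^ a - 1 = 2 ^ i * (2 ^ (a - i) - 1) + (2 ^ i - 1) := by
    rw [Nat.mul_sub_one, h1]; omega
  rw [e, Nat.mul_add_mod, Nat.mod_eq_of_lt (by omega)]

/-- `2 ≤ 2^{m−1}` for `m ≥ 2`. [folklore] -/
private theorem two_le_two_pow_pred {m : ℕ} (hm : 2 ≤ m) : 2 ≤ 2 ^ (m - 1) :=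
  calc (2 : ℕ) = 2 ^ 1 := by norm_num
    _ ≤ 2 ^ (m - 1) := Nat.pow_le_pow_right (by norm_num) (by omega)

/-- **Kummer for the middle coefficient:** all `m − 1` binary positions carry when adding `2^{m−1} − 1` to itself, so
`v₂(binom(2^m − 2, 2^{m−1} − 1)) = m − 1`. [cite: Lai2025TwoAdicZeta, Lemma 6.1 (proof)] -/
theorem padicValNat_choose_middle {m : ℕ} (hm : 2 ≤ m) :
    padicValNat 2 ((2 ^ m - 2).choose (2 ^ (m - 1) - 1)) = m - 1 := by
  haveI := Fact.mk Nat.prime_two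
  have h2m : 2 ^ m = 2 * 2 ^ (m - 1) := by rw [← pow_succ']; congr 1; omega
  have hk1 : 2 ≤ 2 ^ (m - 1) := two_le_two_pow_pred hm
  have hlog : Nat.log 2 (2 ^ m - 2) < m := Nat.log_lt_of_lt_pow (by omega) (by omega)
  rw [padicValNat_choose (show 2 ^ (m - 1) - 1 ≤ 2 ^ m - 2 by omega) hlog]
  have hsub : 2 ^ m - 2 - (2 ^ (m - 1) - 1) = 2 ^ (m - 1) - 1 := by omega
  have hall : (Ico 1 m).filter (fun i => 2 ^ i ≤ (2 ^ (m - 1) - 1) % 2 ^ i + (2 ^ m - 2 - (2 ^ (m - 1) - 1)) % 2 ^ i) =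
      Ico 1 m := by
    refine filter_true_of_mem fun i hi => ?_
    have hi' := mem_Ico.1 hi
    rw [hsub, two_pow_sub_one_mod (show i ≤ m - 1 by omega)]
    have : 2 ≤ 2 ^ i := by
      calc (2 : ℕ) = 2 ^ 1 := by norm_num
        _ ≤ 2 ^ i := Nat.pow_le_pow_right (by norm_num) hi'.1
    omega
  rw [hall, Nat.card_Ico]

/-- **Kummer off the middle:** for `r ≤ 2^m − 2`, `r ≠ 2^{m−1} − 1`, the binary position `m − 1` does not carry, so
`v₂(binom(2^m − 2, r)) ≤ m − 2`. [cite: Lai2025TwoAdicZeta, Lemma 6.1 (proof: "the equality … implies k = k₀")] -/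
theorem padicValNat_choose_le_of_ne_middle {m r : ℕ} (hm : 2 ≤ m) (hr : r ≤ 2 ^ m - 2) (hr0 : r ≠ 2 ^ (m - 1) - 1) :
    padicValNat 2 ((2 ^ m - 2).choose r) ≤ m - 2 := by
  haveI := Fact.mk Nat.prime_two
  have h2m : 2 ^ m = 2 * 2 ^ (m - 1) := by rw [← pow_succ']; congr 1; omega
  have hk1 : 2 ≤ 2 ^ (m - 1) := two_le_two_pow_pred hm
  have hlog : Nat.log 2 (2 ^ m - 2) < m := Nat.log_lt_of_lt_pow (by omega) (by omega)
  rw [padicValNat_choose hr hlog]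
  set M : ℕ := 2 ^ (m - 1) with hM
  -- the position `m − 1` does not carry
  have hnot : ¬ (2 ^ (m - 1) ≤ r % 2 ^ (m - 1) + (2 ^ m - 2 - r) % 2 ^ (m - 1)) := by
    rw [← hM, h2m]
    intro hcarry
    rcases Nat.lt_or_ge r M with h1 | h1
    · rcases Nat.lt_or_ge (2 * M - 2 - r) M with h2 | h2
      · rw [Nat.mod_eq_of_lt h1, Nat.mod_eq_of_lt h2] at hcarry; omega
      · rw [Nat.mod_eq_of_lt h1, Nat.mod_eq_sub_mod h2, Nat.mod_eq_of_lt (by omega)] at hcarry; omega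
    · rw [Nat.mod_eq_sub_mod h1, Nat.mod_eq_of_lt (by omega : r - M < M),
        Nat.mod_eq_of_lt (by omega : 2 * M - 2 - r < M)] at hcarry
      omega
  have hsub : (Ico 1 m).filter (fun i => 2 ^ i ≤ r % 2 ^ i + (2 ^ m - 2 - r) % 2 ^ i) ⊆ Ico 1 (m - 1) := by
    intro i hi
    rw [mem_filter, mem_Ico] at hi
    rw [mem_Ico]
    refine ⟨hi.1.1, lt_of_le_of_ne (by omega) ?_⟩
    rintro rfl
    exact hnot hi.2
  exact (card_le_card hsub).trans (by rw [Nat.card_Ico]; omega)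

/-- `‖binom(2^m−2, 2^{m−1}−1)‖₂ = 2^{−(m−1)}`. [cite: Lai2025TwoAdicZeta, Lemma 6.1] -/
theorem norm_choose_middle {m : ℕ} (hm : 2 ≤ m) :
    ‖(((2 ^ m - 2).choose (2 ^ (m - 1) - 1) : ℕ) : ℚ_[2])‖ = (2 : ℝ) ^ (-((m - 1 : ℕ) : ℤ)) := by
  have h2m : 2 ^ m = 2 * 2 ^ (m - 1) := by rw [← pow_succ']; congr 1; omega
  have hk1 : 1 ≤ 2 ^ (m - 1) := Nat.one_le_two_pow
  have hne : (2 ^ m - 2).choose (2 ^ (m - 1) - 1) ≠ 0 := (Nat.choose_pos (by omega)).ne'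
  rw [norm_natCast_eq_two_zpow hne, padicValNat_choose_middle hm]

/-- `‖binom(2^m−2, r)‖₂ ≥ 2^{−(m−2)}` off the middle. [cite: Lai2025TwoAdicZeta, Lemma 6.1] -/
theorem le_norm_choose_of_ne_middle {m r : ℕ} (hm : 2 ≤ m) (hr : r ≤ 2 ^ m - 2) (hr0 : r ≠ 2 ^ (m - 1) - 1) :
    (2 : ℝ) ^ (-((m - 2 : ℕ) : ℤ)) ≤ ‖(((2 ^ m - 2).choose r : ℕ) : ℚ_[2])‖ := by
  have hne : (2 ^ m - 2).choose r ≠ 0 := (Nat.choose_pos hr).ne'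
  rw [norm_natCast_eq_two_zpow hne]
  refine zpow_le_zpow_right₀ (by norm_num) ?_
  have := padicValNat_choose_le_of_ne_middle hm hr hr0
  omega

/-- **Lemma 6.1 in norm form.**  With `n = 2^m − 1`, `k₀ = 2^{m−1}` (`m ≥ 2`):
`‖(k₀−1)!(n−k₀)!‖₂ = ‖(n−1)!‖₂·2^{m−1}`. [cite: Lai2025TwoAdicZeta, Lemma 6.1 (proof: v₂((k₀−1)!(n−k₀)!) = n−1−(2m−2))] -/
theorem norm_Ffac_middle {m : ℕ} (hm : 2 ≤ m) :
    ‖((Ffac (2 ^ m - 1) (2 ^ (m - 1)) : ℕ) : ℚ_[2])‖ = ‖(((2 ^ m - 1 - 1)! : ℕ) : ℚ_[2])‖ * (2 : ℝ) ^ ((m - 1 : ℕ) : ℤ) := by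
  have h2m : 2 ^ m = 2 * 2 ^ (m - 1) := by rw [← pow_succ']; congr 1; omega
  have hk1 : 1 ≤ 2 ^ (m - 1) := Nat.one_le_two_pow
  have hk : 2 ^ (m - 1) ∈ Icc 1 (2 ^ m - 1) := by rw [mem_Icc]; omega
  have h := congrArg (fun x : ℕ => ‖(x : ℚ_[2])‖) (Ffac_mul_choose hk)
  simp only [Nat.cast_mul, norm_mul] at h
  rw [show 2 ^ m - 1 - 1 = 2 ^ m - 2 by omega, norm_choose_middle hm] at h
  rw [show 2 ^ m - 1 - 1 = 2 ^ m - 2 by omega, ← h, mul_assoc, ← zpow_add₀ (two_ne_zero), neg_add_cancel, zpow_zero,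
    mul_one]

/-- **Lemma 6.1 in norm form** (the inequality): for `1 ≤ k ≤ n = 2^m−1`, `k ≠ k₀ = 2^{m−1}`,
`‖(k−1)!(n−k)!‖₂ ≤ ‖(n−1)!‖₂·2^{m−2} = ½‖(k₀−1)!(n−k₀)!‖₂`, i.e. `v₂((k−1)!(n−k)!) ≥ v₂((k₀−1)!(n−k₀)!) + 1`.
[cite: Lai2025TwoAdicZeta, Lemma 6.1] -/
theorem norm_Ffac_le_of_ne {m k : ℕ} (hm : 2 ≤ m) (hk : k ∈ Icc 1 (2 ^ m - 1)) (hk0 : k ≠ 2 ^ (m - 1)) :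
    ‖((Ffac (2 ^ m - 1) k : ℕ) : ℚ_[2])‖ ≤ ‖(((2 ^ m - 1 - 1)! : ℕ) : ℚ_[2])‖ * (2 : ℝ) ^ ((m - 2 : ℕ) : ℤ) := by
  have h2m : 2 ^ m = 2 * 2 ^ (m - 1) := by rw [← pow_succ']; congr 1; omega
  have hk1 : 1 ≤ 2 ^ (m - 1) := Nat.one_le_two_pow
  have hk' := mem_Icc.1 hk
  have h := congrArg (fun x : ℕ => ‖(x : ℚ_[2])‖) (Ffac_mul_choose hk)
  simp only [Nat.cast_mul, norm_mul] at h
  rw [show 2 ^ m - 1 - 1 = 2 ^ m - 2 by omega] at h ⊢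
  have hC := le_norm_choose_of_ne_middle hm (show k - 1 ≤ 2 ^ m - 2 by omega) (by omega)
  have hCpos : (0 : ℝ) < (2 : ℝ) ^ (-((m - 2 : ℕ) : ℤ)) := by positivity
  -- `‖F_k‖ = ‖(n−1)!‖ / ‖binom‖ ≤ ‖(n−1)!‖ / 2^{−(m−2)}`
  have hF0 : 0 ≤ ‖((Ffac (2 ^ m - 1) k : ℕ) : ℚ_[2])‖ := norm_nonneg _
  calc ‖((Ffac (2 ^ m - 1) k : ℕ) : ℚ_[2])‖
      = ‖((Ffac (2 ^ m - 1) k : ℕ) : ℚ_[2])‖ * (2 : ℝ) ^ (-((m - 2 : ℕ) : ℤ)) * (2 : ℝ) ^ ((m - 2 : ℕ) : ℤ) := by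
        rw [mul_assoc, ← zpow_add₀ two_ne_zero, neg_add_cancel, zpow_zero, mul_one]
    _ ≤ ‖((Ffac (2 ^ m - 1) k : ℕ) : ℚ_[2])‖ * ‖((((2 ^ m - 2).choose (k - 1)) : ℕ) : ℚ_[2])‖ *
          (2 : ℝ) ^ ((m - 2 : ℕ) : ℤ) := by gcongr
    _ = ‖(((2 ^ m - 2)! : ℕ) : ℚ_[2])‖ * (2 : ℝ) ^ ((m - 2 : ℕ) : ℤ) := by rw [h]

/-- **Lemma 6.1, as used:** `‖F_k‖₂ ≤ ½‖F_{k₀}‖₂` for `k ≠ k₀`. [cite: Lai2025TwoAdicZeta, Lemma 6.1] -/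
theorem norm_Ffac_le_half {m k : ℕ} (hm : 2 ≤ m) (hk : k ∈ Icc 1 (2 ^ m - 1)) (hk0 : k ≠ 2 ^ (m - 1)) :
    ‖((Ffac (2 ^ m - 1) k : ℕ) : ℚ_[2])‖ ≤ ‖((Ffac (2 ^ m - 1) (2 ^ (m - 1)) : ℕ) : ℚ_[2])‖ / 2 := by
  rw [norm_Ffac_middle hm]
  refine (norm_Ffac_le_of_ne hm hk hk0).trans (le_of_eq ?_)
  rw [mul_div_assoc]
  congr 1
  rw [eq_div_iff two_ne_zero, ← zpow_add_one₀ two_ne_zero]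
  congr 1; omega

/-- `‖F_k‖₂ ≤ ‖F_{k₀}‖₂` for every `1 ≤ k ≤ n`. [cite: Lai2025TwoAdicZeta, Lemma 6.1] -/
theorem norm_Ffac_le {m k : ℕ} (hm : 2 ≤ m) (hk : k ∈ Icc 1 (2 ^ m - 1)) :
    ‖((Ffac (2 ^ m - 1) k : ℕ) : ℚ_[2])‖ ≤ ‖((Ffac (2 ^ m - 1) (2 ^ (m - 1)) : ℕ) : ℚ_[2])‖ := by
  by_cases hk0 : k = 2 ^ (m - 1)
  · rw [hk0]
  · exact (norm_Ffac_le_half hm hk hk0).trans (by linarith [norm_nonneg (((Ffac (2 ^ m - 1) (2 ^ (m - 1)) : ℕ) : ℚ_[2]))])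

/-- `‖n!‖₂ ≤ ‖F_k‖₂` (`n! = n·binom(n−1,k−1)·F_k`). [cite: Lai2025TwoAdicZeta, Lemma 6.2 (proof: v₂(n!^{2+j}) ≥ (2+j)·v₂)] -/
theorem norm_factorial_le_norm_Ffac {n k : ℕ} (hk : k ∈ Icc 1 n) :
    ‖((n ! : ℕ) : ℚ_[2])‖ ≤ ‖((Ffac n k : ℕ) : ℚ_[2])‖ := by
  have hk' := mem_Icc.1 hk
  have e : n ! = Ffac n k * ((n - 1).choose (k - 1) * n) := by
    rw [← mul_assoc, Ffac_mul_choose hk]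
    rw [show n = (n - 1) + 1 from by omega]
    simp [Nat.factorial_succ, mul_comm]
  rw [e, Nat.cast_mul, norm_mul]
  exact mul_le_of_le_one_right (norm_nonneg _) (norm_natCast_le_one (p := 2) _)

/-! ### «`u ≥ v₂((u+2)(u+1))`»: comparing `binom(s+2, i_*)` with `binom(s+2, s)` -/

/-- `v₂(binom(u+2,2)) + 1 ≤ u` for `u ≥ 1` («`u ≥ v₂((u+2)(u+1))`, true for any integer `u ≥ 1`»).
[cite: Lai2025TwoAdicZeta, Lemma 6.2 (proof, last paragraph)] -/
theorem padicValNat_choose_two_succ_le {u : ℕ} (hu : 1 ≤ u) : padicValNat 2 ((u + 2).choose 2) + 1 ≤ u := by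
  haveI := Fact.mk Nat.prime_two
  have heven : Even ((u + 2) * (u + 1)) := by
    have := Nat.even_mul_succ_self (u + 1); rwa [mul_comm] at this
  have hc : 2 * (u + 2).choose 2 = (u + 1) * (u + 2) := by
    rw [Nat.choose_two_right, show u + 2 - 1 = u + 1 by omega, mul_comm 2, Nat.div_two_mul_two_of_even heven, mul_comm]
  have hcne : (u + 2).choose 2 ≠ 0 := (Nat.choose_pos (by omega)).ne'
  have hv : padicValNat 2 (2 * (u + 2).choose 2) = 1 + padicValNat 2 ((u + 2).choose 2) := by
    rw [padicValNat.mul two_ne_zero hcne, padicValNat_self]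
  have hv' : padicValNat 2 ((u + 1) * (u + 2)) = padicValNat 2 (u + 1) + padicValNat 2 (u + 2) :=
    padicValNat.mul (by omega) (by omega)
  rw [hc, hv'] at hv
  -- one of `u+1`, `u+2` is odd; the other has `v₂ ≤ log₂(u+2) ≤ u`
  have hlog : Nat.log 2 (u + 2) ≤ u := by
    have h : u + 2 < 2 ^ (u + 1) := by
      have := @Nat.lt_two_pow_self u
      have h2 : 2 ≤ 2 ^ u := by
        calc (2 : ℕ) = 2 ^ 1 := by norm_num
          _ ≤ 2 ^ u := Nat.pow_le_pow_right (by norm_num) hu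
      rw [pow_succ]; omega
    have := Nat.log_lt_of_lt_pow (by omega) h
    omega
  have h1 : padicValNat 2 (u + 1) ≤ Nat.log 2 (u + 2) :=
    (padicValNat_le_nat_log _).trans (Nat.log_mono_right (by omega))
  have h2 : padicValNat 2 (u + 2) ≤ Nat.log 2 (u + 2) := padicValNat_le_nat_log _
  rcases Nat.even_or_odd u with he | ho
  · have hodd : ¬ 2 ∣ u + 1 := by
      intro h; obtain ⟨c, hc⟩ := he; omega
    rw [padicValNat.eq_zero_of_not_dvd hodd] at hv
    omega
  · have hodd : ¬ 2 ∣ u + 2 := by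
      intro h; obtain ⟨c, hc⟩ := ho; omega
    rw [padicValNat.eq_zero_of_not_dvd hodd] at hv
    omega

/-- **The binomial comparison of Lemma 6.2/6.3 (proof):** for `1 ≤ u ≤ s`,
`‖binom(s+2, s−u)‖₂ · 2^{−u} ≤ ½‖binom(s+2, s)‖₂` — from `binom(s+2,s−u)·binom(u+2,2) = binom(s+2,s)·binom(s,u)` and
«`u ≥ v₂((u+2)(u+1))`». [cite: Lai2025TwoAdicZeta, Lemma 6.2 (proof: "it suffices to show u + v₂(s!/((s−u)!(u+2)!)) ≥ 0")] -/
theorem norm_choose_mul_half_pow_le {s u : ℕ} (hu : 1 ≤ u) (hus : u ≤ s) :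
    ‖(((s + 2).choose (s - u) : ℕ) : ℚ_[2])‖ * (2⁻¹ : ℝ) ^ u ≤ ‖(((s + 2).choose s : ℕ) : ℚ_[2])‖ / 2 := by
  -- the identity in `ℕ`
  have hid : (s + 2).choose (s - u) * (u + 2).choose 2 = (s + 2).choose s * s.choose u := by
    have h := Nat.choose_mul (n := s + 2) (k := u + 2) (s := 2) (by omega)
    rw [show s + 2 - 2 = s by omega, show u + 2 - 2 = u by omega] at h
    rw [← Nat.choose_symm (show u + 2 ≤ s + 2 by omega), show s + 2 - (u + 2) = s - u by omega] at h
    rw [← Nat.choose_symm (show 2 ≤ s + 2 by omega), show s + 2 - 2 = s by omega] at h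
    exact h
  have hnorm := congrArg (fun x : ℕ => ‖(x : ℚ_[2])‖) hid
  simp only [Nat.cast_mul, norm_mul] at hnorm
  -- `‖binom(u+2,2)‖₂ ≥ 2^{−(u−1)} = 2·2^{−u}`
  have hcne : (u + 2).choose 2 ≠ 0 := (Nat.choose_pos (by omega)).ne'
  have hB : 2 * (2⁻¹ : ℝ) ^ u ≤ ‖(((u + 2).choose 2 : ℕ) : ℚ_[2])‖ := by
    rw [norm_natCast_eq_two_zpow hcne]
    have hv := padicValNat_choose_two_succ_le hu
    rw [show (2 : ℝ) * (2⁻¹ : ℝ) ^ u = (2 : ℝ) ^ (1 - (u : ℤ)) by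
      rw [zpow_sub₀ two_ne_zero, zpow_one, zpow_natCast, inv_pow]; ring]
    exact zpow_le_zpow_right₀ (by norm_num) (by omega)
  have hD : ‖((s.choose u : ℕ) : ℚ_[2])‖ ≤ 1 := norm_natCast_le_one (p := 2) _
  have hA0 : 0 ≤ ‖(((s + 2).choose (s - u) : ℕ) : ℚ_[2])‖ := norm_nonneg _
  have hC0 : 0 ≤ ‖(((s + 2).choose s : ℕ) : ℚ_[2])‖ := norm_nonneg _
  -- `‖A‖·2^{−u} = ‖A‖·(2·2^{−u})/2 ≤ ‖A‖‖B‖/2 = ‖C‖‖D‖/2 ≤ ‖C‖/2`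
  calc ‖(((s + 2).choose (s - u) : ℕ) : ℚ_[2])‖ * (2⁻¹ : ℝ) ^ u
      = ‖(((s + 2).choose (s - u) : ℕ) : ℚ_[2])‖ * (2 * (2⁻¹ : ℝ) ^ u) / 2 := by ring
    _ ≤ ‖(((s + 2).choose (s - u) : ℕ) : ℚ_[2])‖ * ‖(((u + 2).choose 2 : ℕ) : ℚ_[2])‖ / 2 := by gcongr
    _ = ‖(((s + 2).choose s : ℕ) : ℚ_[2])‖ * ‖((s.choose u : ℕ) : ℚ_[2])‖ / 2 := by rw [hnorm]
    _ ≤ ‖(((s + 2).choose s : ℕ) : ℚ_[2])‖ * 1 / 2 := by gcongr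
    _ = ‖(((s + 2).choose s : ℕ) : ℚ_[2])‖ / 2 := by ring

/-! ### Lucas: `binom(2^m − 1, r)` is odd -/

/-- `binom(2^m − 1, r) ≡ 1 (mod 2)` for `r ≤ 2^m − 1` (Lucas' theorem: all binary digits of `2^m − 1` are `1`).
[cite: Lai2025TwoAdicZeta, Lemma 6.2 (proof: "by either Kummer's or Lucas' theorem")] -/
theorem choose_mersenne_mod_two : ∀ (m r : ℕ), r ≤ 2 ^ m - 1 → (2 ^ m - 1).choose r % 2 = 1
  | 0, r, hr => by
    have : r = 0 := by simpa using hr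
    subst this; simp
  | m + 1, r, hr => by
    haveI := Fact.mk Nat.prime_two
    have h := Choose.choose_modEq_choose_mod_mul_choose_div_nat (n := 2 ^ (m + 1) - 1) (k := r) (p := 2)
    have h2 : 2 ^ (m + 1) = 2 * 2 ^ m := pow_succ' 2 m
    have h1m : 1 ≤ 2 ^ m := Nat.one_le_two_pow
    have hn2 : (2 ^ (m + 1) - 1) % 2 = 1 := by omega
    have hn3 : (2 ^ (m + 1) - 1) / 2 = 2 ^ m - 1 := by omega
    rw [hn2, hn3] at h
    have h1 : Nat.choose 1 (r % 2) = 1 := by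
      rcases Nat.mod_two_eq_zero_or_one r with h0 | h0 <;> simp [h0]
    rw [h1, one_mul] at h
    unfold Nat.ModEq at h
    rw [h]
    exact choose_mersenne_mod_two m (r / 2) (by omega)

/-- `‖binom(2^m − 1, r)‖₂ = 1` for `r ≤ 2^m − 1`. [cite: Lai2025TwoAdicZeta, Lemma 6.2 (proof)] -/
theorem norm_choose_mersenne {m r : ℕ} (hr : r ≤ 2 ^ m - 1) : ‖(((2 ^ m - 1).choose r : ℕ) : ℚ_[2])‖ = 1 := by
  refine norm_natCast_of_not_dvd (p := 2) ?_
  intro h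
  have := choose_mersenne_mod_two m r hr
  omega

/-! ## §3. The terms of (eqn_Sum) at natural points after the regrouping: `f_{(ι,λ)}(j) = coefQ · PhiQ(j)` -/

/-- The integer part of the coefficient of the term `(ι, λ)` of (eqn_Sum) (`i = Σ_k ι_k`, `j = s − i`):
`∏_k binom(s+2,ι_k) · n!^{s+2−i} · ∏_k ((k−1)!(n−k)!)^{ι_k}`. [cite: Lai2025TwoAdicZeta, Lemma 6.2 (proof: f_{(i_1,…,i_n,j)})] -/
def coefN (s n i : ℕ) (ι : ℕ → ℕ) : ℕ :=
  (∏ k ∈ Icc 1 n, (s + 2).choose (ι k)) * n ! ^ (s + 2 - i) * ∏ k ∈ Icc 1 n, Ffac n k ^ ι k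

/-- The full coefficient of the term `(ι, λ)`: `coefN · ∏_α (−4)^{λ_α}` (the constants of `g^{(j)}/j!` written factor by
factor). [cite: Lai2025TwoAdicZeta, Lemma 6.2 (proof: f_{(i_1,…,i_n,j)} and "c_k ∈ 2^kℤ₂")] -/
def coefQ (s n i : ℕ) (ι : ℕ → ℕ) (lam : ℕ × ℕ → ℕ) : ℚ :=
  (coefN s n i ι : ℚ) * ∏ α ∈ invIdx s n, (-4 : ℚ) ^ lam α

/-- The function part of the term `(ι, λ)` at a natural `j`:
`binom(j+n,n)^{s+2−i} · ∏_k (binom(j+k−1,k−1)binom(j+n,n−k))^{ι_k} · ∏_α (4j+4a+1)^{−(λ_α+1)}`.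
[cite: Lai2025TwoAdicZeta, Lemma 6.2 (proof: f_{(i_1,…,i_n,j)})] -/
def PhiQ (s n i : ℕ) (ι : ℕ → ℕ) (lam : ℕ × ℕ → ℕ) (j : ℕ) : ℚ :=
  ((j + n).choose n : ℚ) ^ (s + 2 - i) *
    (∏ k ∈ Icc 1 n, (((j + (k - 1)).choose (k - 1) : ℚ) * ((j + n).choose (n - k) : ℚ)) ^ ι k) *
    ∏ α ∈ invIdx s n, ((4 * (j : ℚ) + 4 * (α.1 : ℚ) + 1) ^ (lam α + 1))⁻¹

/-- **The regrouped term** (the display for `f_{(i_1,…,i_n,j)}` at a natural point): for `Σι = i ≤ s`,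
`[∏_k binom(s+2,ι_k)(j+k)^{s+2−ι_k}] · [∏_α (−4)^{λ_α}(4j+4a+1)^{−(λ_α+1)}] = coefQ · PhiQ(j)`.
[cite: Lai2025TwoAdicZeta, Lemma 6.2 (proof: "(t+1)⋯(t+n) = n!binom(t+n,n)", "(t+1)⋯(t+k−1) × (t+k+1)⋯(t+n) = (k−1)!(n−k)!binom(t+k−1,k−1)binom(t+n,n−k)")] -/
theorem term_eq (s n : ℕ) {i : ℕ} (hi : i ≤ s) {ι : ℕ → ℕ} (hι : ι ∈ (Icc 1 n).piAntidiag i)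
    (lam : ℕ × ℕ → ℕ) (j : ℕ) :
    (∏ k ∈ Icc 1 n, (((s + 2).choose (ι k) : ℕ) : ℚ) * ((j : ℚ) + k) ^ (s + 2 - ι k)) *
      (∏ α ∈ invIdx s n, (-4 : ℚ) ^ (lam α) * ((4 * (j : ℚ) + 4 * (α.1 : ℚ) + 1) ^ (lam α + 1))⁻¹) =
    coefQ s n i ι lam * PhiQ s n i ι lam j := by
  have hx : ∀ k ∈ Icc 1 n, (j : ℚ) + k ≠ 0 := fun k hk => by
    have := (mem_Icc.1 hk).1; positivity
  rw [prod_mul_distrib, prod_mul_distrib, prod_pow_sub_eq s n (by omega) hι hx, Pfun_natCast, mul_pow]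
  have hW : ∀ k ∈ Icc 1 n, Wfun n k j ^ ι k =
      ((Ffac n k : ℕ) : ℚ) ^ ι k * (((j + (k - 1)).choose (k - 1) : ℚ) * ((j + n).choose (n - k) : ℚ)) ^ ι k := by
    intro k hk
    rw [Wfun_natCast n j hk, ← mul_pow, Ffac]; push_cast; ring
  rw [prod_congr rfl hW, prod_mul_distrib, coefQ, coefN, PhiQ]
  push_cast
  ring

/-- `f` is smooth at the naturals. [cite: Lai2025TwoAdicZeta, Lemma 6.3 (proof)] -/
theorem contDiffAt_fcore (s n : ℕ) {x : ℚ} (hx : ∀ a ∈ range (n + 1), 4 * x + 4 * (a : ℚ) + 1 ≠ 0) (r : ℕ) :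
    ContDiffAt ℚ r (fcore s n) x := by
  have hx' : ∀ α ∈ invIdx s n, 4 * x + 4 * (α.1 : ℚ) + 1 ≠ 0 := fun α hα =>
    hx α.1 (mem_product.1 hα).1
  have h1 : ContDiffAt ℚ r (fun t : ℚ => ∏ k ∈ Icc 1 n, (t + k) ^ (s + 2)) x := by fun_prop
  have h2 : ContDiffAt ℚ r (fun t : ℚ => ∏ α ∈ invIdx s n, (4 * t + 4 * (α.1 : ℚ) + 1)⁻¹) x := by
    refine contDiffAt_prod fun α hα => ?_
    exact ((contDiffAt_const.mul contDiffAt_id).add contDiffAt_const |>.add contDiffAt_const).inv (hx' α hα)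
  have hf : fcore s n = fun t : ℚ => (∏ k ∈ Icc 1 n, (t + (k : ℚ)) ^ (s + 2)) *
      ∏ α ∈ invIdx s n, (4 * t + 4 * (α.1 : ℚ) + 1)⁻¹ := rfl
  rw [hf]; exact h1.mul h2

/-- **(eqn_Sum) at a natural point:** `B_n^{(s)}(j+¼) = s!·2^{(5s+10)n+2s+4}·Σ_{i≤s}Σ_{ι}Σ_{λ} coefQ·PhiQ(j)`.
[cite: Lai2025TwoAdicZeta, Lemma 6.3 (proof: B_n(t+¼) = 2^{(5s+10)n+2s+4}f(t), (eqn_Sum_2))] -/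
theorem DBsq_natCast_eq_sum (s n j : ℕ) :
    DBsq s n j = (s ! : ℚ) * 2 ^ ((5 * s + 10) * n + 2 * s + 4) *
      ∑ i ∈ range (s + 1), ∑ ι ∈ (Icc 1 n).piAntidiag i, ∑ lam ∈ (invIdx s n).piAntidiag (s - i),
        coefQ s n i ι lam * PhiQ s n i ι lam j := by
  have hx : ∀ a ∈ range (n + 1), 4 * (j : ℚ) + 4 * (a : ℚ) + 1 ≠ 0 := fun a _ => by positivity
  have hf : (fun y : ℚ => Bs s n (y + 1 / 4)) = fun y => (2 : ℚ) ^ ((5 * s + 10) * n + 2 * s + 4) * fcore s n y :=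
    funext (Bs_add_quarter_eq_fcore s n)
  rw [DBsq_natCast, hf, iteratedDeriv_const_mul _ (contDiffAt_fcore s n hx s), iteratedDeriv_eq_factorial_mul_divDeriv,
    divDeriv_fcore s n hx]
  have e : ∑ i ∈ range (s + 1),
      (∑ ι ∈ (Icc 1 n).piAntidiag i, ∏ k ∈ Icc 1 n, (((s + 2).choose (ι k) : ℕ) : ℚ) * ((j : ℚ) + k) ^ (s + 2 - ι k)) *
      (∑ lam ∈ (invIdx s n).piAntidiag (s - i), ∏ α ∈ invIdx s n,
        (-4 : ℚ) ^ (lam α) * ((4 * (j : ℚ) + 4 * (α.1 : ℚ) + 1) ^ (lam α + 1))⁻¹) =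
      ∑ i ∈ range (s + 1), ∑ ι ∈ (Icc 1 n).piAntidiag i, ∑ lam ∈ (invIdx s n).piAntidiag (s - i),
        coefQ s n i ι lam * PhiQ s n i ι lam j := by
    refine sum_congr rfl fun i hi => ?_
    rw [sum_mul_sum]
    exact sum_congr rfl fun ι hι => sum_congr rfl fun lam _ => term_eq s n (by have := mem_range.1 hi; omega) hι lam j
  rw [e]; ring

/-! ### The same terms in `ℚ₂` -/

/-- `binom(j + c, r)` in `ℚ₂`, as a function of `j` (`Cb n n = Cq n`). [cite: Lai2025TwoAdicZeta, Lemma 6.2 (proof)] -/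
def Cb (c r j : ℕ) : ℚ_[2] := (((j + c).choose r : ℕ) : ℚ_[2])

/-- The simple factor `(4j + 4a + 1)^{−1}` of `g` in `ℚ₂`. [cite: Lai2025TwoAdicZeta, Lemma 6.3 (proof: g)] -/
def vq (a j : ℕ) : ℚ_[2] := ((4 : ℚ_[2]) * j + ((4 * a + 1 : ℕ) : ℚ_[2]))⁻¹

/-- The function part `PhiQ` of the term `(ι, λ)` in `ℚ₂`. [cite: Lai2025TwoAdicZeta, Lemma 6.2 (proof: f_{(i_1,…,i_n,j)})] -/
def Phi2 (s n i : ℕ) (ι : ℕ → ℕ) (lam : ℕ × ℕ → ℕ) (j : ℕ) : ℚ_[2] :=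
  Cb n n j ^ (s + 2 - i) * (∏ k ∈ Icc 1 n, (Cb (k - 1) (k - 1) j * Cb n (n - k) j) ^ ι k) *
    ∏ α ∈ invIdx s n, vq α.1 j ^ (lam α + 1)

/-- `PhiQ` casts to `Phi2`. [cite: Lai2025TwoAdicZeta, Lemma 6.2 (proof)] -/
theorem PhiQ_cast (s n i : ℕ) (ι : ℕ → ℕ) (lam : ℕ × ℕ → ℕ) (j : ℕ) :
    ((PhiQ s n i ι lam j : ℚ) : ℚ_[2]) = Phi2 s n i ι lam j := by
  simp only [PhiQ, Phi2, Cb, vq]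
  push_cast
  congr 1
  refine prod_congr rfl fun α _ => ?_
  rw [inv_pow]
  ring

/-- `coefQ` in `ℚ₂`. [cite: Lai2025TwoAdicZeta, Lemma 6.2 (proof)] -/
theorem coefQ_cast (s n i : ℕ) (ι : ℕ → ℕ) (lam : ℕ × ℕ → ℕ) :
    ((coefQ s n i ι lam : ℚ) : ℚ_[2]) = ((coefN s n i ι : ℕ) : ℚ_[2]) * ∏ α ∈ invIdx s n, (-4 : ℚ_[2]) ^ lam α := by
  rw [coefQ]; push_cast; rfl

/-- **(eqn_Sum) for the `2`-adic integrand:** `B_n^{(s)}(j+¼) = s!·2^{(5s+10)n+2s+4}·Σ_{(i,ι,λ)} coefQ·Phi2(j)` in `ℚ₂`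
at every natural `j`. [cite: Lai2025TwoAdicZeta, Lemma 6.3 (proof: (eqn_Sum_2))] -/
theorem DBs_natCast_eq_sum (s n j : ℕ) :
    DBs s n (j : ℤ_[2]) = ((s ! : ℕ) : ℚ_[2]) * 2 ^ ((5 * s + 10) * n + 2 * s + 4) *
      ∑ i ∈ range (s + 1), ∑ ι ∈ (Icc 1 n).piAntidiag i, ∑ lam ∈ (invIdx s n).piAntidiag (s - i),
        ((coefQ s n i ι lam : ℚ) : ℚ_[2]) * Phi2 s n i ι lam j := by
  rw [DBs_natCast, DBsq_natCast_eq_sum]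
  push_cast
  simp only [PhiQ_cast]

/-! ## §4. The dominating index `(0,…,0,i_{k₀} = s,0,…,0)`, `k₀ = 2^{m−1}`, and the comparison of coefficients -/

/-- The dominating multi-index `ι_dom = s·δ_{k₀}` («the index `(0,…,0,i_{2^{m−1}} = s,0,…,0)`»).
[cite: Lai2025TwoAdicZeta, Lemma 6.2 (proof: (eqn_dominating_term))] -/
def iotaDom (s m : ℕ) : ℕ → ℕ := fun k => if k = 2 ^ (m - 1) then s else 0

/-- `1 ≤ k₀ = 2^{m−1} ≤ n = 2^m − 1` (`m ≥ 1`). [cite: Lai2025TwoAdicZeta, Lemma 6.1] -/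
theorem two_pow_pred_mem_Icc {m : ℕ} (hm : 1 ≤ m) : 2 ^ (m - 1) ∈ Icc 1 (2 ^ m - 1) := by
  have h2m : 2 ^ m = 2 * 2 ^ (m - 1) := by rw [← pow_succ']; congr 1; omega
  have hk1 : 1 ≤ 2 ^ (m - 1) := Nat.one_le_two_pow
  rw [mem_Icc]; omega

/-- `ι_dom(k₀) = s`. [cite: Lai2025TwoAdicZeta, Lemma 6.2 (proof)] -/
theorem iotaDom_apply_self (s m : ℕ) : iotaDom s m (2 ^ (m - 1)) = s := if_pos rfl

/-- `ι_dom(k) = 0` for `k ≠ k₀`. [cite: Lai2025TwoAdicZeta, Lemma 6.2 (proof)] -/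
theorem iotaDom_apply_of_ne (s m : ℕ) {k : ℕ} (hk : k ≠ 2 ^ (m - 1)) : iotaDom s m k = 0 := if_neg hk

/-- `ι_dom ∈ [1,n].piAntidiag s`. [cite: Lai2025TwoAdicZeta, Lemma 6.2 (proof: the index set I)] -/
theorem iotaDom_mem (s : ℕ) {m : ℕ} (hm : 1 ≤ m) : iotaDom s m ∈ (Icc 1 (2 ^ m - 1)).piAntidiag s := by
  rw [mem_piAntidiag]
  refine ⟨?_, fun k hk => ?_⟩
  · rw [← add_sum_erase _ _ (two_pow_pred_mem_Icc hm), iotaDom_apply_self,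
      sum_eq_zero (fun k hk => iotaDom_apply_of_ne s m (ne_of_mem_erase hk)), add_zero]
  · by_contra h
    have : k ≠ 2 ^ (m - 1) := fun e => h (e ▸ two_pow_pred_mem_Icc hm)
    exact hk (iotaDom_apply_of_ne s m this)

/-- The dominating coefficient `coef_dom := coefN` at `(s, ι_dom)` (`n = 2^m − 1`). [cite: Lai2025TwoAdicZeta, Lemma 6.2 (proof: f_{(0,…,0,s,0,…,0)})] -/
def cdom (s m : ℕ) : ℕ := coefN s (2 ^ m - 1) s (iotaDom s m)

/-- `coef_dom = binom(s+2,s)·n!²·((k₀−1)!(n−k₀)!)^s` («`(s+2)!/2 · (2^m−1)!² · (2^{m−1}−1)!^{2s}`»).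
[cite: Lai2025TwoAdicZeta, Lemma 6.2 (proof: the display for f_{(0,…,0,i_{2^{m−1}}=s,0,…,0)})] -/
theorem cdom_eq (s : ℕ) {m : ℕ} (hm : 1 ≤ m) :
    cdom s m = (s + 2).choose s * (2 ^ m - 1)! ^ 2 * Ffac (2 ^ m - 1) (2 ^ (m - 1)) ^ s := by
  rw [cdom, coefN, show s + 2 - s = 2 by omega]
  have hk0 := two_pow_pred_mem_Icc hm
  rw [prod_eq_single_of_mem _ hk0 (fun k _ hk => by rw [iotaDom_apply_of_ne s m hk, Nat.choose_zero_right]),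
    prod_eq_single_of_mem _ hk0 (fun k _ hk => by rw [iotaDom_apply_of_ne s m hk, pow_zero]), iotaDom_apply_self]

/-- `coef_dom ≠ 0`. [cite: Lai2025TwoAdicZeta, Lemma 6.2 (proof)] -/
theorem cdom_ne_zero (s : ℕ) {m : ℕ} (hm : 1 ≤ m) : cdom s m ≠ 0 := by
  rw [cdom_eq s hm]
  exact mul_ne_zero (mul_ne_zero (Nat.choose_pos (by omega)).ne' (pow_ne_zero _ (Nat.factorial_ne_zero _)))
    (pow_ne_zero _ (Ffac_ne_zero _ _))

/-- `‖coef_dom‖₂ = ‖binom(s+2,s)‖₂·‖n!‖₂²·‖F_{k₀}‖₂^s`. [cite: Lai2025TwoAdicZeta, Lemma 6.2 (proof: v₂ of the dominating coefficient)] -/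
theorem norm_cdom (s : ℕ) {m : ℕ} (hm : 1 ≤ m) :
    ‖((cdom s m : ℕ) : ℚ_[2])‖ = ‖(((s + 2).choose s : ℕ) : ℚ_[2])‖ * ‖(((2 ^ m - 1)! : ℕ) : ℚ_[2])‖ ^ 2 *
      ‖((Ffac (2 ^ m - 1) (2 ^ (m - 1)) : ℕ) : ℚ_[2])‖ ^ s := by
  rw [cdom_eq s hm]; push_cast; rw [norm_mul, norm_mul, norm_pow, norm_pow]

/-- `‖coefN‖₂ = ∏_k‖binom(s+2,ι_k)‖₂ · ‖n!‖₂^{s+2−i} · ∏_k ‖F_k‖₂^{ι_k}`. [cite: Lai2025TwoAdicZeta, Lemma 6.2 (proof: (eqn_5_3))] -/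
theorem norm_coefN (s n i : ℕ) (ι : ℕ → ℕ) :
    ‖((coefN s n i ι : ℕ) : ℚ_[2])‖ = (∏ k ∈ Icc 1 n, ‖(((s + 2).choose (ι k) : ℕ) : ℚ_[2])‖) *
      ‖((n ! : ℕ) : ℚ_[2])‖ ^ (s + 2 - i) * ∏ k ∈ Icc 1 n, ‖((Ffac n k : ℕ) : ℚ_[2])‖ ^ ι k := by
  rw [coefN]; push_cast; rw [norm_mul, norm_mul, norm_prod, norm_pow, norm_prod]
  simp_rw [norm_pow]

/-- `‖4‖₂ = ¼`. [folklore] -/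
private theorem norm_four_eq : ‖(4 : ℚ_[2])‖ = 4⁻¹ := by
  have h := norm_inv_four
  rw [norm_inv] at h
  rw [← inv_inv ‖(4 : ℚ_[2])‖, h]

/-- `‖∏_α (−4)^{λ_α}‖₂ = 4^{−Σλ}` («`c_k ∈ 2^kℤ₂`»; here the exact power of `4`). [cite: Lai2025TwoAdicZeta, Lemma 6.2 (proof: (eqn_5_2))] -/
theorem norm_prod_neg_four_pow (s n : ℕ) {lam : ℕ × ℕ → ℕ} {d : ℕ} (hlam : lam ∈ (invIdx s n).piAntidiag d) :
    ‖∏ α ∈ invIdx s n, (-4 : ℚ_[2]) ^ lam α‖ = (4⁻¹ : ℝ) ^ d := by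
  rw [norm_prod]
  simp_rw [norm_pow, norm_neg, norm_four_eq]
  rw [prod_pow_eq_pow_sum, (mem_piAntidiag.1 hlam).1]

/-- **The domination of coefficients** ((eqn_other_terms), coefficient part): for every index `(i, ι, λ)` of (eqn_Sum)
other than the dominating one (`n = 2^m − 1`, `m ≥ 2`), `‖coef_{(i,ι,λ)}‖₂ ≤ ½‖coef_dom‖₂` — by Lemma 6.1
(`v₂(n!^{2+j}∏_k((k−1)!(n−k)!)^{i_k}) ≥ 2(m−2) + (s+2)(n−2m+2) − i_*`), the factor `4^{−j}` of `g^{(j)}/j!`, and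
«`u + v₂(s!/((s−u)!(u+2)!)) ≥ 0`» for `u = s − i_* ≥ 1`. [cite: Lai2025TwoAdicZeta, Lemma 6.2 (proof of (eqn_other_terms), (eqn_5_3))] -/
theorem norm_coefQ_le_half (s : ℕ) {m : ℕ} (hm : 2 ≤ m) {i : ℕ} (hi : i ≤ s) {ι : ℕ → ℕ}
    (hι : ι ∈ (Icc 1 (2 ^ m - 1)).piAntidiag i) {lam : ℕ × ℕ → ℕ}
    (hlam : lam ∈ (invIdx s (2 ^ m - 1)).piAntidiag (s - i)) (hne : ¬ (i = s ∧ ι = iotaDom s m)) :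
    ‖((coefQ s (2 ^ m - 1) i ι lam : ℚ) : ℚ_[2])‖ ≤ ‖((cdom s m : ℕ) : ℚ_[2])‖ / 2 := by
  have hm1 : 1 ≤ m := by omega
  have hk0S : 2 ^ (m - 1) ∈ Icc 1 (2 ^ m - 1) := two_pow_pred_mem_Icc hm1
  have hsum : ∑ k ∈ Icc 1 (2 ^ m - 1), ι k = i := (mem_piAntidiag.1 hι).1
  have hsupp : ∀ k, ι k ≠ 0 → k ∈ Icc 1 (2 ^ m - 1) := (mem_piAntidiag.1 hι).2
  have hιle : ι (2 ^ (m - 1)) ≤ i := hsum ▸ single_le_sum (fun _ _ => Nat.zero_le _) hk0S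
  -- `ι k₀ < s` off the dominating index
  have hlt : ι (2 ^ (m - 1)) < s := by
    by_contra h
    apply hne
    refine ⟨by omega, funext fun k => ?_⟩
    by_cases hk : k = 2 ^ (m - 1)
    · rw [hk, iotaDom_apply_self]; omega
    · have hk' : ι k = 0 := by
        by_contra hne0
        have hkS := hsupp k hne0
        have h2 : ι (2 ^ (m - 1)) + ι k ≤ ∑ x ∈ Icc 1 (2 ^ m - 1), ι x := by
          rw [← sum_pair (Ne.symm hk)]
          refine sum_le_sum_of_subset_of_nonneg (fun x hx => ?_) (fun _ _ _ => Nat.zero_le _)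
          rw [mem_insert, mem_singleton] at hx
          rcases hx with rfl | rfl
          exacts [hk0S, hkS]
        omega
      rw [hk', iotaDom_apply_of_ne s m hk]
  rw [coefQ_cast, norm_mul, norm_coefN, norm_cdom s hm1]
  set A := ‖(((s + 2).choose (ι (2 ^ (m - 1))) : ℕ) : ℚ_[2])‖ with hA
  set N := ‖(((2 ^ m - 1) ! : ℕ) : ℚ_[2])‖ with hN
  set F := ‖((Ffac (2 ^ m - 1) (2 ^ (m - 1)) : ℕ) : ℚ_[2])‖ with hF
  have hA0 : 0 ≤ A := norm_nonneg _
  have hN0 : 0 ≤ N := norm_nonneg _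
  have hF0 : 0 ≤ F := norm_nonneg _
  -- (A) the binomials: all are `2`-adic integers, keep the one at `k₀`
  have hStepA : ∏ k ∈ Icc 1 (2 ^ m - 1), ‖(((s + 2).choose (ι k) : ℕ) : ℚ_[2])‖ ≤ A := by
    rw [← mul_prod_erase _ _ hk0S]
    exact mul_le_of_le_one_right hA0
      (prod_le_one (fun _ _ => norm_nonneg _) fun k _ => norm_natCast_le_one (p := 2) _)
  -- (B) `‖n!‖^{s+2−i} ≤ ‖n!‖²‖F_{k₀}‖^{s−i}`
  have hNF : N ≤ F := norm_factorial_le_norm_Ffac hk0S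
  have hStepB : N ^ (s + 2 - i) ≤ N ^ 2 * F ^ (s - i) := by
    rw [show s + 2 - i = 2 + (s - i) by omega, pow_add]
    exact mul_le_mul_of_nonneg_left (pow_le_pow_left₀ hN0 hNF _) (pow_nonneg hN0 _)
  -- (C) Lemma 6.1: `∏_k ‖F_k‖^{ι_k} ≤ ‖F_{k₀}‖^i · 2^{−(i − ι_{k₀})}`
  have hStepC : ∏ k ∈ Icc 1 (2 ^ m - 1), ‖((Ffac (2 ^ m - 1) k : ℕ) : ℚ_[2])‖ ^ ι k ≤
      F ^ i * (2⁻¹ : ℝ) ^ (i - ι (2 ^ (m - 1))) := by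
    rw [← mul_prod_erase _ _ hk0S]
    have hrest : ∏ k ∈ (Icc 1 (2 ^ m - 1)).erase (2 ^ (m - 1)), ‖((Ffac (2 ^ m - 1) k : ℕ) : ℚ_[2])‖ ^ ι k ≤
        ∏ k ∈ (Icc 1 (2 ^ m - 1)).erase (2 ^ (m - 1)), (F * 2⁻¹) ^ ι k := by
      refine prod_le_prod (fun _ _ => pow_nonneg (norm_nonneg _) _) fun k hk => ?_
      have hk' := mem_erase.1 hk
      exact pow_le_pow_left₀ (norm_nonneg _)
        ((norm_Ffac_le_half hm hk'.2 hk'.1).trans_eq (div_eq_mul_inv _ _)) _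
    have hexp : ∑ k ∈ (Icc 1 (2 ^ m - 1)).erase (2 ^ (m - 1)), ι k = i - ι (2 ^ (m - 1)) := by
      have := add_sum_erase _ ι hk0S
      omega
    rw [prod_pow_eq_pow_sum, hexp, mul_pow] at hrest
    calc F ^ ι (2 ^ (m - 1)) * ∏ k ∈ (Icc 1 (2 ^ m - 1)).erase (2 ^ (m - 1)), ‖((Ffac (2 ^ m - 1) k : ℕ) : ℚ_[2])‖ ^ ι k
        ≤ F ^ ι (2 ^ (m - 1)) * (F ^ (i - ι (2 ^ (m - 1))) * (2⁻¹ : ℝ) ^ (i - ι (2 ^ (m - 1)))) :=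
          mul_le_mul_of_nonneg_left hrest (pow_nonneg hF0 _)
      _ = F ^ i * (2⁻¹ : ℝ) ^ (i - ι (2 ^ (m - 1))) := by
          rw [← mul_assoc, ← pow_add, show ι (2 ^ (m - 1)) + (i - ι (2 ^ (m - 1))) = i by omega]
  -- (D) the factor `4^{−(s−i)} ≤ 2^{−(s−i)}` of `g^{(j)}/j!`
  have hStepD : ‖∏ α ∈ invIdx s (2 ^ m - 1), (-4 : ℚ_[2]) ^ lam α‖ ≤ (2⁻¹ : ℝ) ^ (s - i) := by
    rw [norm_prod_neg_four_pow s (2 ^ m - 1) hlam]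
    exact pow_le_pow_left₀ (by norm_num) (by norm_num) _
  -- (E) «u ≥ v₂((u+2)(u+1))»
  have hStepE : A * (2⁻¹ : ℝ) ^ (s - ι (2 ^ (m - 1))) ≤ ‖(((s + 2).choose s : ℕ) : ℚ_[2])‖ / 2 := by
    have h := norm_choose_mul_half_pow_le (s := s) (u := s - ι (2 ^ (m - 1))) (by omega) (by omega)
    rwa [show s - (s - ι (2 ^ (m - 1))) = ι (2 ^ (m - 1)) by omega] at h
  calc (∏ k ∈ Icc 1 (2 ^ m - 1), ‖(((s + 2).choose (ι k) : ℕ) : ℚ_[2])‖) * N ^ (s + 2 - i) *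
        (∏ k ∈ Icc 1 (2 ^ m - 1), ‖((Ffac (2 ^ m - 1) k : ℕ) : ℚ_[2])‖ ^ ι k) *
        ‖∏ α ∈ invIdx s (2 ^ m - 1), (-4 : ℚ_[2]) ^ lam α‖
      ≤ A * (N ^ 2 * F ^ (s - i)) * (F ^ i * (2⁻¹ : ℝ) ^ (i - ι (2 ^ (m - 1)))) * (2⁻¹ : ℝ) ^ (s - i) := by
        have h12 := mul_le_mul hStepA hStepB (pow_nonneg hN0 _) hA0
        have h123 := mul_le_mul h12 hStepC (prod_nonneg fun _ _ => pow_nonneg (norm_nonneg _) _)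
          (mul_nonneg hA0 (by positivity))
        exact mul_le_mul h123 hStepD (norm_nonneg _) (by positivity)
    _ = A * (2⁻¹ : ℝ) ^ (s - ι (2 ^ (m - 1))) * (N ^ 2 * F ^ s) := by
        have e1 : F ^ (s - i) * F ^ i = F ^ s := by rw [← pow_add, show s - i + i = s by omega]
        have e2 : (2⁻¹ : ℝ) ^ (i - ι (2 ^ (m - 1))) * (2⁻¹ : ℝ) ^ (s - i) = (2⁻¹ : ℝ) ^ (s - ι (2 ^ (m - 1))) := by
          rw [← pow_add, show i - ι (2 ^ (m - 1)) + (s - i) = s - ι (2 ^ (m - 1)) by omega]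
        rw [← e1, ← e2]; ring
    _ ≤ ‖(((s + 2).choose s : ℕ) : ℚ_[2])‖ / 2 * (N ^ 2 * F ^ s) :=
        mul_le_mul_of_nonneg_right hStepE (by positivity)
    _ = ‖(((s + 2).choose s : ℕ) : ℚ_[2])‖ * N ^ 2 * F ^ s / 2 := by ring

/-- For every index (dominating or not) `‖coef‖₂ ≤ ‖coef_dom‖₂`. [cite: Lai2025TwoAdicZeta, Lemma 6.2 (proof)] -/
theorem norm_coefQ_le (s : ℕ) {m : ℕ} (hm : 2 ≤ m) {i : ℕ} (hi : i ≤ s) {ι : ℕ → ℕ}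
    (hι : ι ∈ (Icc 1 (2 ^ m - 1)).piAntidiag i) {lam : ℕ × ℕ → ℕ}
    (hlam : lam ∈ (invIdx s (2 ^ m - 1)).piAntidiag (s - i)) :
    ‖((coefQ s (2 ^ m - 1) i ι lam : ℚ) : ℚ_[2])‖ ≤ ‖((cdom s m : ℕ) : ℚ_[2])‖ := by
  by_cases hne : i = s ∧ ι = iotaDom s m
  · obtain ⟨rfl, rfl⟩ := hne
    rw [Nat.sub_self, piAntidiag_zero, mem_singleton] at hlam
    subst hlam
    rw [coefQ_cast, cdom]
    simp
  · exact (norm_coefQ_le_half s hm hi hι hlam hne).trans (by linarith [norm_nonneg ((cdom s m : ℕ) : ℚ_[2])])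

/-- At the dominating index the coefficient IS `coef_dom`: `coefQ(s, ι_dom, 0) = coef_dom`. [cite: Lai2025TwoAdicZeta, Lemma 6.2 (proof)] -/
theorem coefQ_dom (s m : ℕ) : coefQ s (2 ^ m - 1) s (iotaDom s m) 0 = (cdom s m : ℚ) := by
  rw [coefQ, cdom]; simp

/-! ## §5. The Lipschitz data (`Δ ≥ −m+1`, `Δ_m ≥ −m+2`) and the values of the function parts -/

/-- `binom(j+c,r)` is `ℤ₂`-valued. [cite: Lai2025TwoAdicZeta, Lemma 2.5 (1)] -/
theorem bddNat_Cb (c r : ℕ) : BddNat 2 (Cb c r) := BddNat.natCast (p := 2) fun j => (j + c).choose r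

/-- Lemma 2.5 (1) for `binom(t+c,r)`: `Δ ≥ −⌊log₂ r⌋`. [cite: Lai2025TwoAdicZeta, Lemma 2.5 (1)] -/
theorem lipNat_Cb (c r : ℕ) : LipNat 2 ((2 : ℝ) ^ Nat.log 2 r) (Cb c r) := lipNat_choose (p := 2) c r

/-- For `r < 2^m`: `Δ(binom(t+c,r)) ≥ −(m−1)`. [cite: Lai2025TwoAdicZeta, Lemma 2.5 (1), Lemma 6.2 (proof: "Δ(binom(t+n,n)) ≥ −m+1")] -/
theorem lipNat_Cb_of_lt {c r m : ℕ} (hr : r < 2 ^ m) : LipNat 2 ((2 : ℝ) ^ (m - 1)) (Cb c r) := by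
  refine (lipNat_Cb c r).mono (pow_le_pow_right₀ one_le_two ?_)
  rcases eq_or_ne r 0 with rfl | h0
  · simp
  · have := Nat.log_lt_of_lt_pow h0 hr; omega

/-- The simple factors of `g` are `ℤ₂`-valued with `Δ ≥ 2`. [cite: Lai2025TwoAdicZeta, Lemma 6.2 (proof: (eqn_5_2), "c_k ∈ 2^kℤ₂")] -/
theorem lipNat_vq (a : ℕ) : LipNat 2 ‖(4 : ℚ_[2])‖ (vq a) ∧ BddNat 2 (vq a) := lipNat_gq_factor a

/-- `‖(4j+4a+1)^{−1}‖₂ = 1`. [cite: Lai2025TwoAdicZeta, Lemma 6.2 (proof: "g(0) ≡ 1 (mod 2ℤ₂)")] -/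
theorem norm_vq (a j : ℕ) : ‖vq a j‖ = 1 := by
  have ha : ‖(4 : ℚ_[2])‖ < 1 := by rw [norm_four_eq]; norm_num
  rw [vq, norm_inv, norm_linear_eq_one ha (norm_natCast_of_not_dvd (p := 2) (by omega)), inv_one]

/-- `‖4‖₂ ≤ 2^e`. [folklore] -/
private theorem norm_four_le_two_pow (e : ℕ) : ‖(4 : ℚ_[2])‖ ≤ (2 : ℝ) ^ e := by
  rw [norm_four_eq]
  exact (by norm_num : (4⁻¹ : ℝ) ≤ 1).trans (one_le_pow₀ one_le_two)

/-- **(eqn_other_terms), function part:** every `Phi_{(ι,λ)}` is `ℤ₂`-valued with `Δ ≥ −m+1` (`n = 2^m − 1`; Lemma 2.5 (1)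
for the binomials `binom(t+n,n)`, `binom(t+k−1,k−1)`, `binom(t+n,n−k)` and `Δ ≥ 0` for the factors of `g^{(j)}/j!`,
then Lemma 2.5 (2)). [cite: Lai2025TwoAdicZeta, Lemma 6.2 (proof of (eqn_other_terms): "Δ(…) ≥ −m+1")] -/
theorem lipNat_Phi2 (s : ℕ) (m : ℕ) (i : ℕ) (ι : ℕ → ℕ) (lam : ℕ × ℕ → ℕ) :
    LipNat 2 ((2 : ℝ) ^ (m - 1)) (Phi2 s (2 ^ m - 1) i ι lam) ∧ BddNat 2 (Phi2 s (2 ^ m - 1) i ι lam) := by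
  have h2m : 1 ≤ 2 ^ m := Nat.one_le_two_pow
  have hM : (0 : ℝ) ≤ (2 : ℝ) ^ (m - 1) := by positivity
  have hC : ∀ c r : ℕ, r ≤ 2 ^ m - 1 → LipNat 2 ((2 : ℝ) ^ (m - 1)) (Cb c r) := fun c r hr =>
    lipNat_Cb_of_lt (by omega)
  have hv : ∀ a : ℕ, LipNat 2 ((2 : ℝ) ^ (m - 1)) (vq a) := fun a => (lipNat_vq a).1.mono (norm_four_le_two_pow _)
  have b1 : BddNat 2 (fun j => Cb (2 ^ m - 1) (2 ^ m - 1) j ^ (s + 2 - i)) := (bddNat_Cb _ _).pow _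
  have l1 : LipNat 2 ((2 : ℝ) ^ (m - 1)) (fun j => Cb (2 ^ m - 1) (2 ^ m - 1) j ^ (s + 2 - i)) :=
    (hC _ _ le_rfl).pow (bddNat_Cb _ _) hM _
  have b2k : ∀ k ∈ Icc 1 (2 ^ m - 1),
      BddNat 2 (fun j => (Cb (k - 1) (k - 1) j * Cb (2 ^ m - 1) (2 ^ m - 1 - k) j) ^ ι k) := fun k _ =>
    ((bddNat_Cb _ _).mul (bddNat_Cb _ _)).pow _
  have l2k : ∀ k ∈ Icc 1 (2 ^ m - 1), LipNat 2 ((2 : ℝ) ^ (m - 1))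
      (fun j => (Cb (k - 1) (k - 1) j * Cb (2 ^ m - 1) (2 ^ m - 1 - k) j) ^ ι k) := by
    intro k hk
    have hk' := mem_Icc.1 hk
    exact ((hC _ _ (by omega)).mul' (hC _ _ (by omega)) (bddNat_Cb _ _) (bddNat_Cb _ _)).pow
      ((bddNat_Cb _ _).mul (bddNat_Cb _ _)) hM _
  have b2 : BddNat 2
      (fun j => ∏ k ∈ Icc 1 (2 ^ m - 1), (Cb (k - 1) (k - 1) j * Cb (2 ^ m - 1) (2 ^ m - 1 - k) j) ^ ι k) :=
    BddNat.finset_prod _ b2k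
  have l2 : LipNat 2 ((2 : ℝ) ^ (m - 1))
      (fun j => ∏ k ∈ Icc 1 (2 ^ m - 1), (Cb (k - 1) (k - 1) j * Cb (2 ^ m - 1) (2 ^ m - 1 - k) j) ^ ι k) :=
    LipNat.finset_prod _ hM l2k b2k
  have b3a : ∀ α ∈ invIdx s (2 ^ m - 1), BddNat 2 (fun j => vq α.1 j ^ (lam α + 1)) := fun α _ =>
    (lipNat_vq α.1).2.pow _
  have l3a : ∀ α ∈ invIdx s (2 ^ m - 1), LipNat 2 ((2 : ℝ) ^ (m - 1)) (fun j => vq α.1 j ^ (lam α + 1)) :=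
    fun α _ => (hv α.1).pow (lipNat_vq α.1).2 hM _
  have b3 : BddNat 2 (fun j => ∏ α ∈ invIdx s (2 ^ m - 1), vq α.1 j ^ (lam α + 1)) := BddNat.finset_prod _ b3a
  have l3 : LipNat 2 ((2 : ℝ) ^ (m - 1)) (fun j => ∏ α ∈ invIdx s (2 ^ m - 1), vq α.1 j ^ (lam α + 1)) :=
    LipNat.finset_prod _ hM l3a b3a
  exact ⟨(l1.mul' l2 b1 b2).mul' l3 (b1.mul b2) b3, (b1.mul b2).mul b3⟩

/-- `⌊log₂(2^m − 1)⌋ = m − 1` (`m ≥ 1`). [folklore] -/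
private theorem log_two_mersenne {m : ℕ} (hm : 1 ≤ m) : Nat.log 2 (2 ^ m - 1) = m - 1 := by
  have h2m : 2 ^ m = 2 * 2 ^ (m - 1) := by rw [← pow_succ']; congr 1; omega
  have hk1 : 1 ≤ 2 ^ (m - 1) := Nat.one_le_two_pow
  refine Nat.log_eq_of_pow_le_of_lt_pow (by omega) ?_
  rw [show m - 1 + 1 = m by omega]; omega

/-- The dominating function part: `Phi_dom(j) = binom(j+n,n)²·(binom(j+k₀−1,k₀−1)·binom(j+n,n−k₀))^s·∏_α(4j+4a+1)^{−1}`
(«`g(t)·binom(t+2^m−1,2^m−1)²·binom(t+2^{m−1}−1,2^{m−1}−1)^s·binom(t+2^m−1,2^{m−1}−1)^s`»).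
[cite: Lai2025TwoAdicZeta, Lemma 6.2 (proof: the display for f_{(0,…,0,i_{2^{m−1}}=s,0,…,0)})] -/
theorem Phi2_dom_eq (s : ℕ) {m : ℕ} (hm : 1 ≤ m) (j : ℕ) :
    Phi2 s (2 ^ m - 1) s (iotaDom s m) 0 j = Cq (2 ^ m - 1) j ^ 2 *
      (Cb (2 ^ (m - 1) - 1) (2 ^ (m - 1) - 1) j * Cb (2 ^ m - 1) (2 ^ m - 1 - 2 ^ (m - 1)) j) ^ s *
      ∏ α ∈ invIdx s (2 ^ m - 1), vq α.1 j := by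
  rw [Phi2, show s + 2 - s = 2 by omega,
    prod_eq_single_of_mem _ (two_pow_pred_mem_Icc hm) (fun k _ hk => by rw [iotaDom_apply_of_ne s m hk, pow_zero]),
    iotaDom_apply_self]
  simp only [Pi.zero_apply, zero_add, pow_one, Cq, Cb]

/-- **(eqn_dominating_term), function part:** `Δ_m(Phi_dom) ≥ −m+2` — Lemma 2.5 (3) for `binom(t+2^m−1,2^m−1)²`
(`≥ −(m−1)+1`), Lemma 2.5 (1) for `binom(t+2^{m−1}−1,2^{m−1}−1)`, `binom(t+2^m−1,2^{m−1}−1)` (`≥ −(m−2)`) and for `g`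
(`≥ 0`), then Lemma 2.5 (2). [cite: Lai2025TwoAdicZeta, Lemma 6.2 (proof of (eqn_dominating_term): "Δ_m(…) ≥ −m+2")] -/
theorem lipNatMod_Phi2_dom (s : ℕ) {m : ℕ} (hm : 2 ≤ m) :
    LipNatMod 2 m ((2 : ℝ) ^ (m - 2)) (Phi2 s (2 ^ m - 1) s (iotaDom s m) 0) := by
  have hm1 : 1 ≤ m := by omega
  have h2m : 2 ^ m = 2 * 2 ^ (m - 1) := by rw [← pow_succ']; congr 1; omega
  have hk2 : 2 ≤ 2 ^ (m - 1) := two_le_two_pow_pred hm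
  have hM : (0 : ℝ) ≤ (2 : ℝ) ^ (m - 2) := by positivity
  have e : Phi2 s (2 ^ m - 1) s (iotaDom s m) 0 = fun j => Cq (2 ^ m - 1) j ^ 2 *
      (Cb (2 ^ (m - 1) - 1) (2 ^ (m - 1) - 1) j * Cb (2 ^ m - 1) (2 ^ m - 1 - 2 ^ (m - 1)) j) ^ s *
      ∏ α ∈ invIdx s (2 ^ m - 1), vq α.1 j := funext (Phi2_dom_eq s hm1)
  rw [e]
  -- `Δ_m(binom(t+n,n)²) ≥ −(m−1)+1`
  have h1 : LipNatMod 2 m ((2 : ℝ) ^ (m - 2)) (fun j => Cq (2 ^ m - 1) j ^ 2) := by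
    have h := lipNatMod_Cq_sq (n := 2 ^ m - 1) hm1 (by omega)
    rw [log_two_mersenne hm1] at h
    refine h.mono (le_of_eq ?_)
    rw [show m - 1 = (m - 2) + 1 by omega, pow_succ]; ring
  -- the binomials with `r = 2^{m−1} − 1 < 2^{m−1}`: `Δ ≥ −(m−2)`
  have hr : 2 ^ m - 1 - 2 ^ (m - 1) = 2 ^ (m - 1) - 1 := by omega
  have hC : LipNat 2 ((2 : ℝ) ^ (m - 2)) (Cb (2 ^ (m - 1) - 1) (2 ^ (m - 1) - 1)) := by
    have := lipNat_Cb_of_lt (c := 2 ^ (m - 1) - 1) (r := 2 ^ (m - 1) - 1) (m := m - 1) (by omega)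
    rwa [show m - 1 - 1 = m - 2 by omega] at this
  have hC' : LipNat 2 ((2 : ℝ) ^ (m - 2)) (Cb (2 ^ m - 1) (2 ^ m - 1 - 2 ^ (m - 1))) := by
    rw [hr]
    have := lipNat_Cb_of_lt (c := 2 ^ m - 1) (r := 2 ^ (m - 1) - 1) (m := m - 1) (by omega)
    rwa [show m - 1 - 1 = m - 2 by omega] at this
  have b1 : BddNat 2 (fun j => Cq (2 ^ m - 1) j ^ 2) :=
    (BddNat.natCast (p := 2) fun j => (j + (2 ^ m - 1)).choose (2 ^ m - 1)).pow 2
  have b2 : BddNat 2 (fun j =>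
      (Cb (2 ^ (m - 1) - 1) (2 ^ (m - 1) - 1) j * Cb (2 ^ m - 1) (2 ^ m - 1 - 2 ^ (m - 1)) j) ^ s) :=
    ((bddNat_Cb _ _).mul (bddNat_Cb _ _)).pow _
  have l2 : LipNat 2 ((2 : ℝ) ^ (m - 2)) (fun j =>
      (Cb (2 ^ (m - 1) - 1) (2 ^ (m - 1) - 1) j * Cb (2 ^ m - 1) (2 ^ m - 1 - 2 ^ (m - 1)) j) ^ s) :=
    (hC.mul' hC' (bddNat_Cb _ _) (bddNat_Cb _ _)).pow ((bddNat_Cb _ _).mul (bddNat_Cb _ _)) hM _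
  have b3a : ∀ α ∈ invIdx s (2 ^ m - 1), BddNat 2 (vq α.1) := fun α _ => (lipNat_vq α.1).2
  have l3 : LipNat 2 ((2 : ℝ) ^ (m - 2)) (fun j => ∏ α ∈ invIdx s (2 ^ m - 1), vq α.1 j) :=
    LipNat.finset_prod _ hM (fun α _ => (lipNat_vq α.1).1.mono (norm_four_le_two_pow _)) b3a
  have b3 : BddNat 2 (fun j => ∏ α ∈ invIdx s (2 ^ m - 1), vq α.1 j) := BddNat.finset_prod _ b3a
  have h12 := h1.mul (lipNatMod_of_lipNat l2 m) b1 b2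
  have h123 := h12.mul (lipNatMod_of_lipNat l3 m) (b1.mul b2) b3
  rw [max_self, max_self] at h123
  exact h123

/-- `‖binom‖₂ ≤ 1`. [folklore] -/
private theorem norm_Cb_le_one (c r j : ℕ) : ‖Cb c r j‖ ≤ 1 := norm_natCast_le_one (p := 2) _

/-- `‖∏_α (4j+4a+1)^{−e_α}‖₂ = 1`. [cite: Lai2025TwoAdicZeta, Lemma 6.2 (proof: "g(0) ≡ 1 (mod 2ℤ₂)")] -/
theorem norm_prod_vq_pow (S : Finset (ℕ × ℕ)) (e : ℕ × ℕ → ℕ) (j : ℕ) : ‖∏ α ∈ S, vq α.1 j ^ e α‖ = 1 := by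
  rw [norm_prod]; exact prod_eq_one fun α _ => by rw [norm_pow, norm_vq, one_pow]

/-- The middle block is `ℤ₂`-valued. [cite: Lai2025TwoAdicZeta, Lemma 6.2 (proof)] -/
theorem norm_prod_Cb_pow_le_one (n : ℕ) (ι : ℕ → ℕ) (j : ℕ) :
    ‖∏ k ∈ Icc 1 n, (Cb (k - 1) (k - 1) j * Cb n (n - k) j) ^ ι k‖ ≤ 1 := by
  rw [norm_prod]
  refine prod_le_one (fun _ _ => norm_nonneg _) fun k _ => ?_
  rw [norm_pow, norm_mul]
  exact pow_le_one₀ (by positivity) (mul_le_one₀ (norm_Cb_le_one _ _ _) (norm_nonneg _) (norm_Cb_le_one _ _ _))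

/-- Every `Phi` is `ℤ₂`-valued at the naturals. [cite: Lai2025TwoAdicZeta, Lemma 6.2 (proof)] -/
theorem norm_Phi2_le_one (s n i : ℕ) (ι : ℕ → ℕ) (lam : ℕ × ℕ → ℕ) (j : ℕ) : ‖Phi2 s n i ι lam j‖ ≤ 1 := by
  rw [Phi2, norm_mul, norm_mul, norm_prod_vq_pow, mul_one]
  refine mul_le_one₀ ?_ (norm_nonneg _) (norm_prod_Cb_pow_le_one n ι j)
  rw [norm_pow]; exact pow_le_one₀ (norm_nonneg _) (norm_Cb_le_one _ _ _)

/-- **The terms `k ≥ 1` of the Riemann sum:** `‖Phi(j)‖₂ ≤ ¼` for `1 ≤ j < 2^m` (`n = 2^m − 1`, `i ≤ s`): the factor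
`binom(j+n,n)^{s+2−i}` with «`binom(k+2^m−1,2^m−1)` even for `1 ≤ k ≤ 2^m−1`» and `s+2−i ≥ 2`.
[cite: Lai2025TwoAdicZeta, Lemma 6.2 (proof of (eqn_5_1))] -/
theorem norm_Phi2_le_quarter (s : ℕ) {m : ℕ} (hm : 1 ≤ m) {i : ℕ} (hi : i ≤ s) (ι : ℕ → ℕ) (lam : ℕ × ℕ → ℕ)
    {j : ℕ} (hj1 : 1 ≤ j) (hj : j < 2 ^ m) : ‖Phi2 s (2 ^ m - 1) i ι lam j‖ ≤ 4⁻¹ := by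
  rw [Phi2, norm_mul, norm_mul, norm_prod_vq_pow, mul_one]
  have hC : ‖Cb (2 ^ m - 1) (2 ^ m - 1) j‖ ≤ 2⁻¹ := norm_Cq_le_half hm hj1 hj
  have h1 : ‖Cb (2 ^ m - 1) (2 ^ m - 1) j ^ (s + 2 - i)‖ ≤ 4⁻¹ := by
    rw [norm_pow]
    calc ‖Cb (2 ^ m - 1) (2 ^ m - 1) j‖ ^ (s + 2 - i) ≤ ‖Cb (2 ^ m - 1) (2 ^ m - 1) j‖ ^ 2 :=
          pow_le_pow_of_le_one (norm_nonneg _) (norm_Cb_le_one _ _ _) (by omega)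
      _ ≤ (2⁻¹ : ℝ) ^ 2 := pow_le_pow_left₀ (norm_nonneg _) hC 2
      _ = 4⁻¹ := by norm_num
  calc ‖Cb (2 ^ m - 1) (2 ^ m - 1) j ^ (s + 2 - i)‖ *
        ‖∏ k ∈ Icc 1 (2 ^ m - 1), (Cb (k - 1) (k - 1) j * Cb (2 ^ m - 1) (2 ^ m - 1 - k) j) ^ ι k‖
      ≤ 4⁻¹ * 1 := mul_le_mul h1 (norm_prod_Cb_pow_le_one _ ι j) (norm_nonneg _) (by norm_num)
    _ = 4⁻¹ := mul_one _

/-- **The term `k = 0` of the Riemann sum:** `‖Phi_dom(0)‖₂ = 1` (`binom(n,n) = binom(k₀−1,k₀−1) = 1`, `binom(2^m−1,·)` odd,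
«`g(0) ≡ 1 (mod 2ℤ₂)`»). [cite: Lai2025TwoAdicZeta, Lemma 6.2 (proof of (eqn_5_1))] -/
theorem norm_Phi2_dom_zero (s : ℕ) {m : ℕ} (hm : 1 ≤ m) : ‖Phi2 s (2 ^ m - 1) s (iotaDom s m) 0 0‖ = 1 := by
  rw [Phi2_dom_eq s hm, norm_mul, norm_mul]
  have e3 : ‖∏ α ∈ invIdx s (2 ^ m - 1), vq α.1 0‖ = 1 := by
    rw [norm_prod]; exact prod_eq_one fun α _ => norm_vq _ _
  have e1 : Cq (2 ^ m - 1) 0 = 1 := by simp [Cq]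
  have e2 : Cb (2 ^ (m - 1) - 1) (2 ^ (m - 1) - 1) 0 = 1 := by simp [Cb]
  have e4 : ‖Cb (2 ^ m - 1) (2 ^ m - 1 - 2 ^ (m - 1)) 0‖ = 1 := by
    rw [Cb, zero_add]; exact norm_choose_mersenne (Nat.sub_le _ _)
  rw [e1, e2, e3, one_pow, norm_one, one_mul, mul_one, norm_pow, norm_mul, e4, norm_one, one_mul, one_pow]

/-! ## §6. Lemma 6.3: the normalised integrand `Ψ = K^{−1}B_n^{(s)}(t+¼)`, `K = s!·2^{(5s+10)n+2s+4}·coef_dom` -/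

/-- The normalised term `(coef/coef_dom)·Phi` of (eqn_Sum). [cite: Lai2025TwoAdicZeta, Lemma 6.3 (proof)] -/
def PsiTerm (s m i : ℕ) (ι : ℕ → ℕ) (lam : ℕ × ℕ → ℕ) (j : ℕ) : ℚ_[2] :=
  ((cdom s m : ℕ) : ℚ_[2])⁻¹ * ((coefQ s (2 ^ m - 1) i ι lam : ℚ) : ℚ_[2]) * Phi2 s (2 ^ m - 1) i ι lam j

/-- `Ψ(j) := Σ_{(i,ι,λ)} (coef/coef_dom)·Phi(j) = f^{(s)}(j)/(s!·coef_dom)` (`n = 2^m − 1`). [cite: Lai2025TwoAdicZeta, Lemma 6.3 (proof: (eqn_Sum_2))] -/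
def Psi (s m j : ℕ) : ℚ_[2] :=
  ∑ i ∈ range (s + 1), ∑ ι ∈ (Icc 1 (2 ^ m - 1)).piAntidiag i,
    ∑ lam ∈ (invIdx s (2 ^ m - 1)).piAntidiag (s - i), PsiTerm s m i ι lam j

/-- The normalising constant `K := s!·2^{(5s+10)n+2s+4}·coef_dom`. [cite: Lai2025TwoAdicZeta, Lemma 6.3 (proof: B_n(t+¼) = 2^{(5s+10)n+2s+4}f(t))] -/
def Kn (s m : ℕ) : ℚ_[2] :=
  ((s ! : ℕ) : ℚ_[2]) * 2 ^ ((5 * s + 10) * (2 ^ m - 1) + 2 * s + 4) * ((cdom s m : ℕ) : ℚ_[2])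

/-- `K ≠ 0`. [cite: Lai2025TwoAdicZeta, Lemma 6.3 (proof)] -/
theorem Kn_ne_zero (s : ℕ) {m : ℕ} (hm : 1 ≤ m) : Kn s m ≠ 0 :=
  mul_ne_zero (mul_ne_zero (by exact_mod_cast Nat.factorial_ne_zero s) (pow_ne_zero _ two_ne_zero))
    (by exact_mod_cast cdom_ne_zero s hm)

/-- The normalised integrand `Ψ(t) := K^{−1}·B_n^{(s)}(t+¼)` on `ℤ₂`. [cite: Lai2025TwoAdicZeta, Lemma 6.3 (proof)] -/
def Fzs (s m : ℕ) (t : ℤ_[2]) : ℚ_[2] := (Kn s m)⁻¹ * DBs s (2 ^ m - 1) t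

/-- `Ψ` at the naturals is the triple sum `Psi`. [cite: Lai2025TwoAdicZeta, Lemma 6.3 (proof: (eqn_Sum_2))] -/
theorem Fzs_natCast (s : ℕ) {m : ℕ} (hm : 1 ≤ m) (j : ℕ) : Fzs s m (j : ℤ_[2]) = Psi s m j := by
  have hc : ((cdom s m : ℕ) : ℚ_[2]) ≠ 0 := by exact_mod_cast cdom_ne_zero s hm
  have hs : ((s ! : ℕ) : ℚ_[2]) ≠ 0 := by exact_mod_cast Nat.factorial_ne_zero s
  have e : ∀ S : ℚ_[2], (Kn s m)⁻¹ * (((s ! : ℕ) : ℚ_[2]) * 2 ^ ((5 * s + 10) * (2 ^ m - 1) + 2 * s + 4) * S) =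
      ((cdom s m : ℕ) : ℚ_[2])⁻¹ * S := fun S => by
    rw [Kn]; field_simp
  rw [Fzs, DBs_natCast_eq_sum, e, Psi, mul_sum]
  refine sum_congr rfl fun i _ => ?_
  rw [mul_sum]
  refine sum_congr rfl fun ι _ => ?_
  rw [mul_sum]
  refine sum_congr rfl fun lam _ => ?_
  rw [PsiTerm, mul_assoc]

/-- The Riemann sums of `Ψ` tend to `K^{−1}·T_n`. [cite: Lai2025TwoAdicZeta, Definition 3.2 / Lemma 6.3 (proof)] -/
theorem tendsto_volkenbornSum_Fzs (s m : ℕ) :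
    Tendsto (volkenbornSum 2 (Fzs s m)) atTop (𝓝 ((Kn s m)⁻¹ * Ts s (2 ^ m - 1))) := by
  refine ((tendsto_volkenbornSum_DBs_Ts s (2 ^ m - 1)).const_mul (Kn s m)⁻¹).congr fun N => ?_
  rw [← smul_eq_mul, ← volkenbornSum_smul]
  rfl

/-- Each normalised term has `Δ_m ≥ −m+2`: the dominating one by `lipNatMod_Phi2_dom`, the others by `Δ ≥ −m+1` and a
coefficient ratio in `2ℤ₂`. [cite: Lai2025TwoAdicZeta, Lemma 6.2 (proof: (eqn_dominating_term) and (eqn_other_terms))] -/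
theorem lipNatMod_PsiTerm (s : ℕ) {m : ℕ} (hm : 2 ≤ m) {i : ℕ} (hi : i ∈ range (s + 1)) {ι : ℕ → ℕ}
    (hι : ι ∈ (Icc 1 (2 ^ m - 1)).piAntidiag i) {lam : ℕ × ℕ → ℕ}
    (hlam : lam ∈ (invIdx s (2 ^ m - 1)).piAntidiag (s - i)) :
    LipNatMod 2 m ((2 : ℝ) ^ (m - 2)) (PsiTerm s m i ι lam) := by
  have hm1 : 1 ≤ m := by omega
  have hi' : i ≤ s := by have := mem_range.1 hi; omega
  have hc : ((cdom s m : ℕ) : ℚ_[2]) ≠ 0 := by exact_mod_cast cdom_ne_zero s hm1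
  by_cases hne : i = s ∧ ι = iotaDom s m
  · obtain ⟨his, hιd⟩ := hne
    subst hιd
    rw [his] at hlam ⊢
    rw [Nat.sub_self, piAntidiag_zero, mem_singleton] at hlam
    subst hlam
    have e : PsiTerm s m s (iotaDom s m) 0 = Phi2 s (2 ^ m - 1) s (iotaDom s m) 0 := by
      funext j; rw [PsiTerm, coefQ_dom]; push_cast; rw [inv_mul_cancel₀ hc, one_mul]
    rw [e]; exact lipNatMod_Phi2_dom s hm
  · have hL := lipNat_Phi2 s m i ι lam
    have h := (lipNatMod_of_lipNat hL.1 m).const_mul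
      (((cdom s m : ℕ) : ℚ_[2])⁻¹ * ((coefQ s (2 ^ m - 1) i ι lam : ℚ) : ℚ_[2]))
    refine h.mono ?_
    have hc0 : 0 < ‖((cdom s m : ℕ) : ℚ_[2])‖ := norm_pos_iff.2 hc
    have hq := norm_coefQ_le_half s hm hi' hι hlam hne
    rw [norm_mul, norm_inv]
    calc ‖((cdom s m : ℕ) : ℚ_[2])‖⁻¹ * ‖((coefQ s (2 ^ m - 1) i ι lam : ℚ) : ℚ_[2])‖ * (2 : ℝ) ^ (m - 1)
        ≤ ‖((cdom s m : ℕ) : ℚ_[2])‖⁻¹ * (‖((cdom s m : ℕ) : ℚ_[2])‖ / 2) * (2 : ℝ) ^ (m - 1) := by gcongr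
      _ = (2 : ℝ) ^ (m - 2) := by
          field_simp
          rw [show m - 1 = (m - 2) + 1 by omega, pow_succ]; ring

/-- **`Δ_m(Ψ) ≥ −m+2`.** [cite: Lai2025TwoAdicZeta, Lemma 6.3 (proof: Lemma 2.5 (2) applied to (eqn_Sum_2))] -/
theorem lipNatMod_Psi (s : ℕ) {m : ℕ} (hm : 2 ≤ m) : LipNatMod 2 m ((2 : ℝ) ^ (m - 2)) (Psi s m) := by
  have hM : (0 : ℝ) ≤ (2 : ℝ) ^ (m - 2) := by positivity
  refine LipNatMod.finset_sum (F := fun i j => ∑ ι ∈ (Icc 1 (2 ^ m - 1)).piAntidiag i,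
      ∑ lam ∈ (invIdx s (2 ^ m - 1)).piAntidiag (s - i), PsiTerm s m i ι lam j) _ hM fun i hi => ?_
  refine LipNatMod.finset_sum
    (F := fun ι j => ∑ lam ∈ (invIdx s (2 ^ m - 1)).piAntidiag (s - i), PsiTerm s m i ι lam j) _ hM fun ι hι => ?_
  exact LipNatMod.finset_sum (F := fun lam j => PsiTerm s m i ι lam j) _ hM fun lam hlam =>
    lipNatMod_PsiTerm s hm hi hι hlam

/-- `‖(coef/coef_dom)·Phi(j)‖₂ ≤ ‖Phi(j)‖₂`. [cite: Lai2025TwoAdicZeta, Lemma 6.2 (proof)] -/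
theorem norm_PsiTerm_le (s : ℕ) {m : ℕ} (hm : 2 ≤ m) {i : ℕ} (hi : i ∈ range (s + 1)) {ι : ℕ → ℕ}
    (hι : ι ∈ (Icc 1 (2 ^ m - 1)).piAntidiag i) {lam : ℕ × ℕ → ℕ}
    (hlam : lam ∈ (invIdx s (2 ^ m - 1)).piAntidiag (s - i)) (j : ℕ) :
    ‖PsiTerm s m i ι lam j‖ ≤ ‖Phi2 s (2 ^ m - 1) i ι lam j‖ := by
  have hi' : i ≤ s := by have := mem_range.1 hi; omega
  have hc0 : 0 < ‖((cdom s m : ℕ) : ℚ_[2])‖ := norm_pos_iff.2 (by exact_mod_cast cdom_ne_zero s (by omega))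
  rw [PsiTerm, norm_mul]
  refine mul_le_of_le_one_left (norm_nonneg _) ?_
  rw [norm_mul, norm_inv]
  calc ‖((cdom s m : ℕ) : ℚ_[2])‖⁻¹ * ‖((coefQ s (2 ^ m - 1) i ι lam : ℚ) : ℚ_[2])‖
      ≤ ‖((cdom s m : ℕ) : ℚ_[2])‖⁻¹ * ‖((cdom s m : ℕ) : ℚ_[2])‖ := by
        gcongr; exact norm_coefQ_le s hm hi' hι hlam
    _ = 1 := inv_mul_cancel₀ hc0.ne'

/-- Off the dominating index `‖(coef/coef_dom)·Phi(j)‖₂ ≤ ½`. [cite: Lai2025TwoAdicZeta, Lemma 6.2 (proof: (eqn_other_terms))] -/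
theorem norm_PsiTerm_le_half (s : ℕ) {m : ℕ} (hm : 2 ≤ m) {i : ℕ} (hi : i ≤ s) {ι : ℕ → ℕ}
    (hι : ι ∈ (Icc 1 (2 ^ m - 1)).piAntidiag i) {lam : ℕ × ℕ → ℕ}
    (hlam : lam ∈ (invIdx s (2 ^ m - 1)).piAntidiag (s - i)) (hne : ¬ (i = s ∧ ι = iotaDom s m)) (j : ℕ) :
    ‖PsiTerm s m i ι lam j‖ ≤ 2⁻¹ := by
  have hc0 : 0 < ‖((cdom s m : ℕ) : ℚ_[2])‖ := norm_pos_iff.2 (by exact_mod_cast cdom_ne_zero s (by omega))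
  rw [PsiTerm, norm_mul, norm_mul, norm_inv]
  calc ‖((cdom s m : ℕ) : ℚ_[2])‖⁻¹ * ‖((coefQ s (2 ^ m - 1) i ι lam : ℚ) : ℚ_[2])‖ * ‖Phi2 s (2 ^ m - 1) i ι lam j‖
      ≤ ‖((cdom s m : ℕ) : ℚ_[2])‖⁻¹ * (‖((cdom s m : ℕ) : ℚ_[2])‖ / 2) * 1 := by
        gcongr
        · exact norm_coefQ_le_half s hm hi hι hlam hne
        · exact norm_Phi2_le_one _ _ _ _ _ _
    _ = 2⁻¹ := by field_simp

/-- **The Riemann-sum terms `k ≥ 1`:** `‖Ψ(j)‖₂ ≤ ¼` for `1 ≤ j < 2^m`. [cite: Lai2025TwoAdicZeta, Lemma 6.2 (proof of (eqn_5_1))] -/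
theorem norm_Psi_le_quarter (s : ℕ) {m : ℕ} (hm : 2 ≤ m) {j : ℕ} (hj1 : 1 ≤ j) (hj : j < 2 ^ m) :
    ‖Psi s m j‖ ≤ 4⁻¹ := by
  refine IsUltrametricDist.norm_sum_le_of_forall_le_of_nonneg (by norm_num) fun i hi => ?_
  refine IsUltrametricDist.norm_sum_le_of_forall_le_of_nonneg (by norm_num) fun ι hι => ?_
  refine IsUltrametricDist.norm_sum_le_of_forall_le_of_nonneg (by norm_num) fun lam hlam => ?_
  exact (norm_PsiTerm_le s hm hi hι hlam j).trans
    (norm_Phi2_le_quarter s (by omega) (by have := mem_range.1 hi; omega) ι lam hj1 hj)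

/-- **The Riemann-sum term `k = 0`:** `‖Ψ(0)‖₂ = 1` — the dominating term is a unit, all others lie in `2ℤ₂`.
[cite: Lai2025TwoAdicZeta, Lemma 6.2 (proof of (eqn_5_1) and (eqn_other_terms))] -/
theorem norm_Psi_zero (s : ℕ) {m : ℕ} (hm : 2 ≤ m) : ‖Psi s m 0‖ = 1 := by
  classical
  have hm1 : 1 ≤ m := by omega
  have hc : ((cdom s m : ℕ) : ℚ_[2]) ≠ 0 := by exact_mod_cast cdom_ne_zero s hm1
  have h0mem : (0 : ℕ × ℕ → ℕ) ∈ (invIdx s (2 ^ m - 1)).piAntidiag (s - s) := by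
    rw [Nat.sub_self, piAntidiag_zero]; exact mem_singleton_self 0
  -- the pieces
  have hR1 : ‖∑ i ∈ range s, ∑ ι ∈ (Icc 1 (2 ^ m - 1)).piAntidiag i,
      ∑ lam ∈ (invIdx s (2 ^ m - 1)).piAntidiag (s - i), PsiTerm s m i ι lam 0‖ ≤ 2⁻¹ := by
    refine IsUltrametricDist.norm_sum_le_of_forall_le_of_nonneg (by norm_num) fun i hi => ?_
    refine IsUltrametricDist.norm_sum_le_of_forall_le_of_nonneg (by norm_num) fun ι hι => ?_
    refine IsUltrametricDist.norm_sum_le_of_forall_le_of_nonneg (by norm_num) fun lam hlam => ?_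
    have hi' := mem_range.1 hi
    exact norm_PsiTerm_le_half s hm hi'.le hι hlam (fun h => absurd h.1 (by omega)) 0
  have hR2 : ‖∑ ι ∈ ((Icc 1 (2 ^ m - 1)).piAntidiag s).erase (iotaDom s m), PsiTerm s m s ι 0 0‖ ≤ 2⁻¹ := by
    refine IsUltrametricDist.norm_sum_le_of_forall_le_of_nonneg (by norm_num) fun ι hι => ?_
    have hι' := mem_erase.1 hι
    exact norm_PsiTerm_le_half s hm le_rfl hι'.2 h0mem (fun h => hι'.1 h.2) 0
  have hdom : ‖PsiTerm s m s (iotaDom s m) 0 0‖ = 1 := by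
    rw [PsiTerm, coefQ_dom]; push_cast
    rw [inv_mul_cancel₀ hc, one_mul, norm_Phi2_dom_zero s hm1]
  -- the splitting `Ψ(0) = R₁ + (dom + R₂)`
  have hsplit : ∑ ι ∈ (Icc 1 (2 ^ m - 1)).piAntidiag s,
      ∑ lam ∈ (invIdx s (2 ^ m - 1)).piAntidiag (s - s), PsiTerm s m s ι lam 0 =
      PsiTerm s m s (iotaDom s m) 0 0 +
        ∑ ι ∈ ((Icc 1 (2 ^ m - 1)).piAntidiag s).erase (iotaDom s m), PsiTerm s m s ι 0 0 := by
    rw [← add_sum_erase _ _ (iotaDom_mem s hm1), Nat.sub_self, piAntidiag_zero]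
    simp only [sum_singleton]
  rw [Psi, sum_range_succ, hsplit]
  have hin : ‖PsiTerm s m s (iotaDom s m) 0 0 +
      ∑ ι ∈ ((Icc 1 (2 ^ m - 1)).piAntidiag s).erase (iotaDom s m), PsiTerm s m s ι 0 0‖ = 1 := by
    have hne : ‖PsiTerm s m s (iotaDom s m) 0 0‖ ≠
        ‖∑ ι ∈ ((Icc 1 (2 ^ m - 1)).piAntidiag s).erase (iotaDom s m), PsiTerm s m s ι 0 0‖ := by
      rw [hdom]; exact ne_of_gt (hR2.trans_lt (by norm_num))
    rw [Padic.add_eq_max_of_ne hne, hdom, max_eq_left (hR2.trans (by norm_num))]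
  have hne' : ‖∑ i ∈ range s, ∑ ι ∈ (Icc 1 (2 ^ m - 1)).piAntidiag i,
      ∑ lam ∈ (invIdx s (2 ^ m - 1)).piAntidiag (s - i), PsiTerm s m i ι lam 0‖ ≠
      ‖PsiTerm s m s (iotaDom s m) 0 0 +
        ∑ ι ∈ ((Icc 1 (2 ^ m - 1)).piAntidiag s).erase (iotaDom s m), PsiTerm s m s ι 0 0‖ := by
    rw [hin]; exact ne_of_lt (hR1.trans_lt (by norm_num))
  rw [Padic.add_eq_max_of_ne hne', hin, max_eq_right (hR1.trans (by norm_num))]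

/-- **`‖Σ_{k<2^m} Ψ(k)‖₂ = 1`.** [cite: Lai2025TwoAdicZeta, Lemma 6.2 (proof of (eqn_5_1))] -/
theorem norm_sum_Psi_eq_one (s : ℕ) {m : ℕ} (hm : 2 ≤ m) : ‖∑ j ∈ range (2 ^ m), Psi s m j‖ = 1 := by
  have h2m : 1 ≤ 2 ^ m := Nat.one_le_two_pow
  rw [← Finset.sum_range_add_sum_Ico _ h2m, Finset.sum_range_one]
  have hrest : ‖∑ k ∈ Ico 1 (2 ^ m), Psi s m k‖ ≤ 4⁻¹ :=
    IsUltrametricDist.norm_sum_le_of_forall_le_of_nonneg (by norm_num) fun k hk =>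
      norm_Psi_le_quarter s hm (mem_Ico.1 hk).1 (mem_Ico.1 hk).2
  have hne : ‖Psi s m 0‖ ≠ ‖∑ k ∈ Ico 1 (2 ^ m), Psi s m k‖ := by
    rw [norm_Psi_zero s hm]; exact ne_of_gt (hrest.trans_lt (by norm_num))
  rw [Padic.add_eq_max_of_ne hne, norm_Psi_zero s hm, max_eq_left (hrest.trans (by norm_num))]

/-- The Riemann sum of `Ψ` at level `m` has norm `2^m`. [cite: Lai2025TwoAdicZeta, Lemma 6.3 (proof: (eqn_5_1))] -/
theorem norm_volkenbornSum_Fzs (s : ℕ) {m : ℕ} (hm : 2 ≤ m) : ‖volkenbornSum 2 (Fzs s m) m‖ = (2 : ℝ) ^ m := by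
  rw [volkenbornSum_def, norm_smul, norm_inv, norm_pow, Padic.norm_p, inv_pow, inv_inv]
  have e : ∑ k ∈ range (2 ^ m), Fzs s m (k : ℤ_[2]) = ∑ k ∈ range (2 ^ m), Psi s m k :=
    sum_congr rfl fun k _ => Fzs_natCast s (by omega) k
  push_cast
  rw [e, norm_sum_Psi_eq_one s hm, mul_one]

/-- **Lemma 6.3 (exact valuation), general `s`:** for `n = 2^m − 1`, `m ≥ 2`,
`‖T_n‖₂ = ‖s!·2^{(5s+10)n+2s+4}·binom(s+2,s)·n!²·((k₀−1)!(n−k₀)!)^s‖₂ · 2^m`, i.e.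
`v₂(T_n) = (5s+10)n + 2s + 4 + v₂(s!binom(s+2,s)) + 2v₂(n!) + s·v₂((k₀−1)!(n−k₀)!) − m`
(`= (6s+12)n − (2s+3)m + 3s + v₂((s+2)!) + 3` with `v₂(n!) = n − m`, `v₂((2^{m−1}−1)!) = (n+1)/2 − m`; with
`v₂(d_n) = m−1` this is the printed `v₂(d_n^{2s+3}T_n) = (6s+12)n + s + v₂((s+2)!)`).  Proof as printed: `Δ_m(Ψ) ≥ −m+2`,
so `∫Ψ ≡ 2^{−m}Σ_{k<2^m}Ψ(k) (mod 2^{−m+1})`, and the sum is a `2`-adic unit. [cite: Lai2025TwoAdicZeta, Lemma 6.3] -/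
theorem norm_Ts_mersenne (s : ℕ) {m : ℕ} (hm : 2 ≤ m) : ‖Ts s (2 ^ m - 1)‖ = ‖Kn s m‖ * (2 : ℝ) ^ m := by
  have hm1 : 1 ≤ m := by omega
  have hM0 : (0 : ℝ) ≤ (2 : ℝ) ^ (m - 2) := by positivity
  have hLip : LipNatMod 2 m ((2 : ℝ) ^ (m - 2)) (fun k : ℕ => Fzs s m (k : ℤ_[2])) := by
    intro k h
    show ‖Fzs s m ((k + 2 ^ m * h : ℕ) : ℤ_[2]) - Fzs s m ((k : ℕ) : ℤ_[2])‖ ≤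
      (2 : ℝ) ^ (m - 2) * ‖((2 ^ m * h : ℕ) : ℚ_[2])‖
    rw [Fzs_natCast s hm1, Fzs_natCast s hm1]
    exact lipNatMod_Psi s hm k h
  have hI := tendsto_volkenbornSum_Fzs s m
  have hclose := norm_sub_volkenbornSum_le_of_lipNatMod (p := 2) hM0 hLip hI
  have hSm := norm_volkenbornSum_Fzs s hm
  have hlt : ‖(Kn s m)⁻¹ * Ts s (2 ^ m - 1) - volkenbornSum 2 (Fzs s m) m‖ < ‖volkenbornSum 2 (Fzs s m) m‖ := by
    rw [hSm]
    have h1 : ‖(Kn s m)⁻¹ * Ts s (2 ^ m - 1) - volkenbornSum 2 (Fzs s m) m‖ ≤ (2 : ℝ) ^ (m - 1 : ℕ) := by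
      refine hclose.trans (le_of_eq ?_)
      push_cast
      rw [show m - 1 = (m - 2) + 1 by omega, pow_succ]; ring
    exact h1.trans_lt (pow_lt_pow_right₀ (by norm_num) (by omega))
  have hkey : ‖(Kn s m)⁻¹ * Ts s (2 ^ m - 1)‖ = (2 : ℝ) ^ m := by
    have e : (Kn s m)⁻¹ * Ts s (2 ^ m - 1) =
        ((Kn s m)⁻¹ * Ts s (2 ^ m - 1) - volkenbornSum 2 (Fzs s m) m) + volkenbornSum 2 (Fzs s m) m := by ring
    rw [e, Padic.add_eq_max_of_ne (ne_of_lt hlt), max_eq_right hlt.le, hSm]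
  rw [norm_mul, norm_inv] at hkey
  have hc : ‖Kn s m‖ ≠ 0 := norm_ne_zero_iff.2 (Kn_ne_zero s hm1)
  field_simp at hkey
  linarith [hkey]

/-- **Lemma 6.3 ("In particular `d_n^{2s+3}T_n ≠ 0`")**, general `s`, along `n = 2^m − 1`, `m ≥ 2`.
[cite: Lai2025TwoAdicZeta, Lemma 6.3 ("In particular, d_n^{2s+3}T_n ≠ 0")] -/
theorem Ts_mersenne_ne_zero (s : ℕ) {m : ℕ} (hm : 2 ≤ m) : Ts s (2 ^ m - 1) ≠ 0 := by
  intro h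
  have h1 := norm_Ts_mersenne s hm
  rw [h, norm_zero] at h1
  have h2 : 0 < ‖Kn s m‖ * (2 : ℝ) ^ m := mul_pos (norm_pos_iff.2 (Kn_ne_zero s (by omega))) (by positivity)
  linarith

/-! ### The smallness bound `‖T_n‖₂ ≤ 2^{(2s+3)m − (6s+12)n − 3s − 4}` -/

/-- `‖K‖₂ ≤ 2^{−((5s+10)n+2s+4)}·‖n!‖₂²·‖F_{k₀}‖₂^s`. [cite: Lai2025TwoAdicZeta, Lemma 6.3 (proof: v₂ of the prefactors)] -/
theorem norm_Kn_le (s : ℕ) {m : ℕ} (hm : 1 ≤ m) :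
    ‖Kn s m‖ ≤ (2 : ℝ) ^ (-(((5 * s + 10) * (2 ^ m - 1) + 2 * s + 4 : ℕ) : ℤ)) *
      (‖(((2 ^ m - 1)! : ℕ) : ℚ_[2])‖ ^ 2 * ‖((Ffac (2 ^ m - 1) (2 ^ (m - 1)) : ℕ) : ℚ_[2])‖ ^ s) := by
  rw [Kn, norm_mul, norm_mul, norm_two_pow, norm_cdom s hm]
  have h1 : ‖((s ! : ℕ) : ℚ_[2])‖ ≤ 1 := norm_natCast_le_one (p := 2) _
  have h2 : ‖(((s + 2).choose s : ℕ) : ℚ_[2])‖ ≤ 1 := norm_natCast_le_one (p := 2) _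
  set N := ‖(((2 ^ m - 1)! : ℕ) : ℚ_[2])‖
  set F := ‖((Ffac (2 ^ m - 1) (2 ^ (m - 1)) : ℕ) : ℚ_[2])‖
  set P := (2 : ℝ) ^ (-(((5 * s + 10) * (2 ^ m - 1) + 2 * s + 4 : ℕ) : ℤ))
  have hP : 0 ≤ P := by positivity
  calc ‖((s ! : ℕ) : ℚ_[2])‖ * P * (‖(((s + 2).choose s : ℕ) : ℚ_[2])‖ * N ^ 2 * F ^ s)
      ≤ 1 * P * (1 * N ^ 2 * F ^ s) := by gcongr
    _ = P * (N ^ 2 * F ^ s) := by ring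

/-- `‖F_{k₀}‖₂ = ‖(2^{m−1}−1)!‖₂² ≤ 2^{2m − 2^m}` (Legendre: `v₂((2^{m−1}−1)!) = 2^{m−1} − m`).
[cite: Lai2025TwoAdicZeta, Lemma 6.2 (proof: "v₂((2^{m−1}−1)!) = n/2 − m + 1/2")] -/
theorem norm_Ffac_middle_le {m : ℕ} (hm : 2 ≤ m) :
    ‖((Ffac (2 ^ m - 1) (2 ^ (m - 1)) : ℕ) : ℚ_[2])‖ ≤ (2 : ℝ) ^ (2 * (m : ℤ) - 2 ^ m) := by
  have hm1 : 1 ≤ m := by omega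
  have h2m : 2 ^ m = 2 * 2 ^ (m - 1) := by rw [← pow_succ']; congr 1; omega
  have hk2 : 2 ≤ 2 ^ (m - 1) := two_le_two_pow_pred hm
  have e : Ffac (2 ^ m - 1) (2 ^ (m - 1)) = (2 ^ (m - 1) - 1)! * (2 ^ (m - 1) - 1)! := by
    rw [Ffac, show 2 ^ m - 1 - 2 ^ (m - 1) = 2 ^ (m - 1) - 1 by omega]
  have hlog : Nat.log 2 (2 ^ (m - 1) - 1) + 1 = m - 1 := by
    have := log_two_mersenne (m := m - 1) (by omega)
    rw [show m - 1 - 1 = m - 2 by omega] at this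
    omega
  have hf : ‖(((2 ^ (m - 1) - 1)! : ℕ) : ℚ_[2])‖ ≤ (2 : ℝ) ^ ((m : ℤ) - 2 ^ (m - 1)) := by
    have h := norm_factorial_le (2 ^ (m - 1) - 1)
    rw [hlog] at h
    refine h.trans (zpow_le_zpow_right₀ (by norm_num) (le_of_eq ?_))
    rw [Nat.cast_sub hm1, Nat.cast_sub (by omega : 1 ≤ 2 ^ (m - 1))]
    push_cast; ring
  rw [e, Nat.cast_mul, norm_mul]
  have h2mZ : ((2 : ℤ) ^ m) = 2 * 2 ^ (m - 1) := by exact_mod_cast h2m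
  calc ‖(((2 ^ (m - 1) - 1)! : ℕ) : ℚ_[2])‖ * ‖(((2 ^ (m - 1) - 1)! : ℕ) : ℚ_[2])‖
      ≤ (2 : ℝ) ^ ((m : ℤ) - 2 ^ (m - 1)) * (2 : ℝ) ^ ((m : ℤ) - 2 ^ (m - 1)) :=
        mul_le_mul hf hf (norm_nonneg _) (by positivity)
    _ = (2 : ℝ) ^ (2 * (m : ℤ) - 2 ^ m) := by
        rw [← zpow_add₀ (two_ne_zero)]
        congr 1
        linarith

/-- **The `2`-adic smallness of the linear forms**, general `s`, along `n = 2^m − 1` (`m ≥ 2`):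
`‖T_n‖₂ ≤ 2^{(2s+3)m − (6s+12)n − 3s − 4}` (printed: `|d_n^{2s+3}T_n|₂ = 2^{(−6s−12+o(1))n}`; here through Legendre's
`v₂(a!) ≥ a − ⌊log₂a⌋ − 1` for `n!` and `(k₀−1)!`). [cite: Lai2025TwoAdicZeta, Lemma 6.3 ("|d_n^{2s+3}T_n|_2 = 2^{(−6s−12+o(1))n}")] -/
theorem norm_Ts_mersenne_le (s : ℕ) {m : ℕ} (hm : 2 ≤ m) :
    ‖Ts s (2 ^ m - 1)‖ ≤
      (2 : ℝ) ^ ((2 * s + 3) * (m : ℤ) - (6 * s + 12) * ((2 ^ m - 1 : ℕ) : ℤ) - 3 * s - 4) := by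
  have hm1 : 1 ≤ m := by omega
  have h1m : 1 ≤ 2 ^ m := Nat.one_le_two_pow
  have hlog : Nat.log 2 (2 ^ m - 1) + 1 = m := by rw [log_two_mersenne hm1]; omega
  have hF := norm_Ffac_middle_le hm
  have hK := norm_Kn_le s hm1
  rw [norm_Ts_mersenne s hm]
  obtain ⟨n, hn, hn'⟩ : ∃ n : ℕ, 2 ^ m - 1 = n ∧ ((2 : ℤ) ^ m) = n + 1 :=
    ⟨2 ^ m - 1, rfl, by rw [Nat.cast_sub h1m]; push_cast; ring⟩
  rw [hn] at hF hK hlog ⊢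
  rw [hn'] at hF
  have hfact : ‖((n ! : ℕ) : ℚ_[2])‖ ≤ (2 : ℝ) ^ ((m : ℤ) - n) := by
    have h := norm_factorial_le n
    rwa [hlog] at h
  have hN0 : 0 ≤ ‖((n ! : ℕ) : ℚ_[2])‖ := norm_nonneg _
  have hF0 : 0 ≤ ‖((Ffac n (2 ^ (m - 1)) : ℕ) : ℚ_[2])‖ := norm_nonneg _
  calc ‖Kn s m‖ * (2 : ℝ) ^ m
      ≤ (2 : ℝ) ^ (-(((5 * s + 10) * n + 2 * s + 4 : ℕ) : ℤ)) *
          (((2 : ℝ) ^ ((m : ℤ) - n)) ^ 2 * ((2 : ℝ) ^ (2 * (m : ℤ) - (n + 1))) ^ s) * (2 : ℝ) ^ m := by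
        refine mul_le_mul_of_nonneg_right (hK.trans ?_) (by positivity)
        gcongr
    _ = (2 : ℝ) ^ ((2 * s + 3) * (m : ℤ) - (6 * s + 12) * (n : ℤ) - 3 * s - 4) := by
        rw [sq, ← zpow_natCast ((2 : ℝ) ^ (2 * (m : ℤ) - (n + 1))) s, ← zpow_mul, ← zpow_natCast (2 : ℝ) m]
        simp only [← zpow_add₀ (two_ne_zero : (2 : ℝ) ≠ 0)]
        congr 1
        push_cast
        ring

end Literature.NumberTheory.Irrationality.Lai2025TwoAdic
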